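import Summits.SmoothPoincare4.SmoothPoincare4.Theses.CongruenceShadows
import Literature.Topology.FourManifolds.SurfaceGroupAmalgam

/-!
# Disproof of WaldhausenPairs — findings

Crux `Summit.SmoothPoincare4.SmoothPoincare4.Theses.CongruenceShadows.WaldhausenPairs`
(item stmt-SmoothPoincare4-14592, route CongruenceShadows):

  ∀ m K, IsGroupTrisection (3+3m) (m+1) PUnit K → ∀ i ≠ j, ∃ α : S ≃* S,
    (N i).map α = K i ∧ (N j).map α = K j,       N := s4Kernels.stabilizeIter m.

VERDICT SO FAR: resists (no kill). Mathematically it is the composite of published theorems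
(Leininger–Reid 2002 Lemma 2.2 / Jaco 1969 = single kernels are handlebody kernels; van Kampen;
Kneser–Stallings + Perelman = closed orientable 3-manifold with free π₁ of rank k is #ᵏ S¹×S²;
Waldhausen 1968 = its genus-g Heegaard splitting is unique, ordered form via the side swap of the
standard splitting; Dehn–Nielsen–Baer = the diffeomorphism of pairs is an automorphism of S_g).
A Lean refutation could only come from a mis-typed signature; the probes below found none.

Findings (all `theorem`s below are sorry-free unless marked NEAR-MISS):
* (elaboration) the decl elaborates; body read back literally (W.lean, `Iff.rfl`).
* (non-vacuity) `stabilizeIter_isGroupTrisection` : the hypothesis is inhabited at every `m`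
  by `K = N`; `conclusion_at_standard` : the conclusion holds there with `α = 1`.
* (load-bearing, §A) `waldhausenPairs_false_without_pairFree` : dropping `free_pairQuotient`
  makes it FALSE (m = 0, K = (⟪a₁,a₂,a₃⟫, ⟪a₁,a₂,a₃⟫, ⟪b₁,b₂,b₃⟫): two equal kernels cannot be the
  image of the distinct N₀ ≠ N₁). Any proof must use the pairwise pushout (the 3-manifold Hᵢ ∪ Hⱼ).
* (load-bearing, §A) `waldhausenPairs_false_without_freeQuotient` : dropping `free_quotient`
  makes it FALSE (m = 0, Kᵢ = ⟪a₁,a₂,a₃,bᵢ⟫: pair quotients ≅ F₁, triple trivial, but S/K₀ ≅ F₂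
  while S/N₀ ≅ F₃; F₂ ≄ F₃ by counting homs to ℤ/2). Any proof must use that single quotients
  have rank exactly g (Leininger–Reid / Jaco: epis onto F_g are geometric).
* (decomposition for planners, §C') `waldhausenPairs_of_facts` : the crux follows by pure algebra
  from two printed fact shapes, `SingleKernelOrbit (3+3m)` (LR02 Lemma 2.2 + DNB: handlebody
  kernels form one Aut-orbit) and `HeegaardGroupTransitive (3+3m) (m+1)` (Waldhausen for #ᵏS¹×S²
  + Kneser–Stallings–Perelman + DNB, relative to a fixed handlebody kernel) — these are the two
  facts to vendor; nothing about the third kernel or the triple quotient is needed.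
* (not load-bearing, information for the prover) the fields `triple` (G = PUnit) and
  `free_quotient l` for the third index l ∉ {i,j} are never needed: the statement is a statement
  about ORDERED HEEGAARD PAIRS (A,B) ◁ S_g with S/A ≅ S/B ≅ F_g, S/⟪A ∪ B⟫ ≅ F_k — see
  `waldhausenPairs_of_heegaardPairOrbit` (§C).
* (refuted strengthening, §B) `not_pairTransfer` : "every α with α(N_i) = K_i also has
  α(N_j) = K_j" is FALSE already at K = N, m = 0 (the transvection b₂ ↦ b₂a₂ fixes N₀ and moves
  N₁): the stabiliser of one handlebody kernel is not contained in the stabiliser of the other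
  (handlebody group ≠ Heegaard group), so the two single-kernel standardisations given by
  Leininger–Reid cannot be performed one at a time — the SIMULTANEOUS α is exactly Waldhausen's
  theorem and needs the 3-manifold Hᵢ ∪ Hⱼ.
* (transport / not rigid, §B') `IsGroupTrisection.map_mulEquiv` : the hypothesis is invariant under
  `K ↦ α • K` (α ∈ Aut S_g); `not_rigid` : `τ • N` satisfies the hypothesis, agrees with `N` in
  slot 0 and differs in slot 1 — the hypothesis never determines `K_j` from `K_i`, `α = 1` /
  inner automorphisms never suffice.
* (ordered = unordered, §B'') `swapEquiv` / `exists_swap_s4Kernels` : the standard genus-3 pair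
  `(N₀, N₁)` has a side swap `σ ∈ Aut S_3` (`σ N₀ = N₁`, `σ N₁ = N₀`; half-twists
  `a ↦ b⁻¹, b ↦ bab⁻¹` on the two non-shared handles), so the ORDERED conclusion of the crux is
  consistent with Waldhausen's unordered uniqueness (`crossed_of_pair_zero_one`).
* (refuted strengthening, §B''') `not_pairsDetermineThird` : "α standardising the PAIR (K₀,K₁)
  also standardises K₂" is FALSE at K = N, m = 0: the Dehn twist `T₀` about the SHARED curve a₁
  lies in the Heegaard group Stab N₀ ∩ Stab N₁ and moves N₂ (`dehnEquiv 0`). This is the exact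
  gap between the crux (pairs; a 3-dimensional theorem) and `Iso N K` (SPC4-hard): the three
  pairwise α_{ij} of WaldhausenPairs differ by Heegaard-group elements not fixing the third kernel.
* (load-bearing, §A', cycle 2) `waldhausenPairs_false_without_normal` : dropping `normal`
  makes it FALSE (m = 0, K = (⟨a₁,a₂,b₃⟩ generated-not-normally-generated, N₁, N₂): all seven
  quotients agree with `N`'s, yet `α(N₀)` is normal and `⟨a₁,a₂,b₃⟩` is not — detected by
  `ρ : S_3 → Sym(3)`). Load-bearing table of `IsGroupTrisection` now complete: `normal`,
  `free_quotient`, `free_pairQuotient` load-bearing; `triple` not. The §A witness `(⟪a⟫,⟪a⟫,⟪b⟫)`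
  is the unbalanced `(3;3,0,0)` trisection of `S⁴` (remark after §A').
* (structure, §S, cycle 2) `SlotSymmetry.stabilizeIter_slotSymmetric` : the standard triple
  `N = s4Kernels.stabilizeIter m` is `S₃`-symmetric in `Aut S_{3+3m}` at EVERY `m` (relator-fixing
  free automorphisms, block sums, induction); hence ordered = unordered at every genus
  (`exists_swap_stabilizeIter`), all ordered standard pairs are equivalent
  (`exists_aut_pair_stabilizeIter`), the hypothesis is slot-symmetric (`isGroupTrisection_comp_perm`)
  and THE CRUX IS ITS (0,1)-SLICE (`waldhausenPairs_iff_slice`).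
* (targets, §T, cycle 2) all 5 + 6 + 7 registered stubs of the three lines
  (`jaco-splitting-homomorphism`, `agk-realization-device`, `zieschang-orbit-dnb-regluing`)
  SURVIVE cheap attacks (junk models of `BoundaryData` / `IsBoundaryGluingWith` / `IsHandlebody`,
  degenerate genera, dropped hypotheses); the algebraic cores of the transport and van Kampen
  stubs are proved there (`kernelPair_transport_core`, `isFreeOfRank_of_ker_eq`) — what remains
  of those stubs is topological plumbing only.
* LANDED in the tree (Theorems/WaldhausenPairs/Negative/): LoadBearing.lean (p72830, accepted),
  PairTransferFalse.lean (p73442: not_pairTransfer, IsGroupTrisection.map_mulEquiv, not_rigid),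
  StandardPairSymmetries.lean (p74687: swap / Dehn twists, not_pairsDetermineThird);
  cycle 2: NormalityLoadBearing.lean (p75896, ACCEPTED: waldhausenPairs_false_without_normal);
  Literature/Topology/FourManifolds/StandardTrisectionSlotSymmetry.lean (p76319, review pending:
  §S without the slice theorem, namespace `Literature.Topology.FourManifolds`, importable by all routes).
* (open strengthening, not attackable here) `TripleStandard` (one α for all three kernels,
  i.e. `Iso N K`) = SPC4_g ∧ 4-d Waldhausen_g (Meier–Schirmer–Zupan Conj. 3.11); no finite model.
-/

set_option linter.dupNamespace false

noncomputable section

namespace Summit.SmoothPoincare4.SmoothPoincare4.Cruxes.WaldhausenPairs.Disproof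

open Literature.Topology.FourManifolds Subgroup
open Summit.SmoothPoincare4.SmoothPoincare4.Theses.CongruenceShadows (WaldhausenPairs)

/-! ## §0 Generator kernels in `S_g` (small API over `GroupTrisections.lean`) -/

variable {g : ℕ}

/-- The normal closure of a set of standard generators of `S_g`. [folklore] -/
def genKernel (S : Finset (surfaceGen g)) : Subgroup (SurfaceGroup g) :=
  normalClosure (PresentedGroup.of '' (S : Set (surfaceGen g)))

/-- Generator kernels are normal (they are normal closures). [folklore] -/
instance genKernel_normal (S : Finset (surfaceGen g)) : (genKernel S).Normal := by
  unfold genKernel; infer_instance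

/-- The generators in `S` lie in `genKernel S`. [folklore] -/
theorem of_mem_genKernel {S : Finset (surfaceGen g)} {x : surfaceGen g} (hx : x ∈ S) :
    (PresentedGroup.of x : SurfaceGroup g) ∈ genKernel S :=
  subset_normalClosure ⟨x, hx, rfl⟩

/-- A generator kernel dies under erasing any larger handle-meeting set. [folklore] -/
theorem genKernel_le_ker (S T : Finset (surfaceGen g))
    (hT : ∀ i : Fin g, (i, false) ∈ T ∨ (i, true) ∈ T) (h : S ⊆ T) :
    genKernel S ≤ (eraseHom T hT).ker := by
  refine normalClosure_le_normal ?_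
  rintro _ ⟨x, hx, rfl⟩
  exact of_mem_ker_eraseHom T hT (h hx)

/-- A surviving generator is not in the generator kernel. [folklore] -/
theorem of_not_mem_genKernel {S : Finset (surfaceGen g)}
    (hS : ∀ i : Fin g, (i, false) ∈ S ∨ (i, true) ∈ S) {x : surfaceGen g} (hx : x ∉ S) :
    (PresentedGroup.of x : SurfaceGroup g) ∉ genKernel S := by
  intro h
  have h1 := genKernel_le_ker S S hS le_rfl h
  rw [MonoidHom.mem_ker, eraseHom_of, eraseGen_of_not_mem hx] at h1
  exact FreeGroup.of_ne_one _ h1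

/-- `S_g ⧸ ⟪generators in S⟫` is free on the survivors (rank count). [folklore] -/
theorem isFreeOfRank_quot_genKernel (S : Finset (surfaceGen g))
    (hS : ∀ i : Fin g, (i, false) ∈ S ∨ (i, true) ∈ S) {n : ℕ}
    (hn : Fintype.card {x // x ∉ S} = n) :
    IsFreeOfRank (SurfaceGroup g ⧸ normalClosure ((genKernel S : Subgroup (SurfaceGroup g)) :
      Set (SurfaceGroup g))) n := by
  refine isFreeOfRank_quotient_of_erase S hS _ (fun x hx => ?_) ?_ hn
  · exact subset_normalClosure (of_mem_genKernel hx)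
  · exact normalClosure_le_normal (genKernel_le_ker S S hS le_rfl)

/-- The pair quotient of two generator kernels is free on the common survivors. [folklore] -/
theorem isFreeOfRank_quot_genKernel_pair (S T : Finset (surfaceGen g))
    (hS : ∀ i : Fin g, (i, false) ∈ S ∨ (i, true) ∈ S) {n : ℕ}
    (hn : Fintype.card {x // x ∉ S ∪ T} = n) :
    IsFreeOfRank (SurfaceGroup g ⧸ normalClosure (((genKernel S : Subgroup (SurfaceGroup g)) :
      Set (SurfaceGroup g)) ∪ (genKernel T : Subgroup (SurfaceGroup g)))) n := by
  have hST : ∀ i : Fin g, (i, false) ∈ S ∪ T ∨ (i, true) ∈ S ∪ T :=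
    fun i => (hS i).imp (Finset.mem_union_left _) (Finset.mem_union_left _)
  refine isFreeOfRank_quotient_of_erase (S ∪ T) hST _ (fun x hx => ?_) ?_ hn
  · rw [Finset.mem_union] at hx
    rcases hx with hx | hx
    · exact subset_normalClosure (Or.inl (of_mem_genKernel hx))
    · exact subset_normalClosure (Or.inr (of_mem_genKernel hx))
  · exact normalClosure_le_normal (Set.union_subset
      (genKernel_le_ker S _ hST Finset.subset_union_left)
      (genKernel_le_ker T _ hST Finset.subset_union_right))

/-- If the generator sets of a kernel triple cover all generators, the triple quotient is
trivial. [folklore] -/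
theorem tripleQuotient_trivial (S : Fin 3 → Finset (surfaceGen g))
    (hcover : ∀ x : surfaceGen g, ∃ i, x ∈ S i) :
    Nonempty (TrisectionKernels.tripleQuotient (fun i => genKernel (S i)) ≃* (PUnit : Type)) := by
  have hU : ∀ k : Fin g, (k, false) ∈ (Finset.univ : Finset (surfaceGen g)) ∨
      (k, true) ∈ (Finset.univ : Finset (surfaceGen g)) := fun k => Or.inl (Finset.mem_univ _)
  haveI : IsEmpty {x : surfaceGen g // x ∉ (Finset.univ : Finset (surfaceGen g))} :=
    ⟨fun x => x.2 (Finset.mem_univ _)⟩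
  refine ⟨(quotientEquivFreeGroupErase Finset.univ hU _ ?_ ?_).trans MulEquiv.ofUnique⟩
  · intro x _
    obtain ⟨i, hi⟩ := hcover x
    exact subset_normalClosure (Set.mem_iUnion.2 ⟨i, of_mem_genKernel hi⟩)
  · refine normalClosure_le_normal (Set.iUnion_subset fun i => ?_)
    exact genKernel_le_ker (S i) _ hU (Finset.subset_univ _)

/-! ## §0' The standard triple at every genus: non-vacuity -/

/-- The hypothesis of the crux is inhabited at every `m`: `N = s4Kernels.stabilizeIter m` is a
`(3+3m, m+1)` group trisection of the trivial group (induction on the two discharged named facts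
of `GroupTrisections.lean`). [cite: AbramsGayKirby2018, Def. 3] -/
theorem stabilizeIter_isGroupTrisection (m : ℕ) :
    IsGroupTrisection (3 + 3 * m) (m + 1) (PUnit : Type) (s4Kernels.stabilizeIter m) := by
  induction m with
  | zero => exact s4Kernels_isGroupTrisection_holds
  | succ m ih => exact stabilize_isGroupTrisection_holds _ _ _ _ ih

/-- At `K = N` the conclusion holds with `α = 1` (so the conclusion is satisfiable and the
statement is not refutable by its standard model). [folklore] -/
theorem conclusion_at_standard (m : ℕ) (i j : Fin 3) :
    ∃ α : SurfaceGroup (3 + 3 * m) ≃* SurfaceGroup (3 + 3 * m),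
      (s4Kernels.stabilizeIter m i).map α.toMonoidHom = s4Kernels.stabilizeIter m i ∧
      (s4Kernels.stabilizeIter m j).map α.toMonoidHom = s4Kernels.stabilizeIter m j :=
  ⟨MulEquiv.refl _, by simp, by simp⟩

/-! ## §0'' Genus 3 (`m = 0`): the standard kernels are pairwise distinct -/

/-- `s4Kernels i` is the generator kernel of `s4Gens i`. [folklore] -/
theorem s4Kernels_eq_genKernel (i : Fin 3) : s4Kernels i = genKernel (s4Gens i) :=
  s4Kernels_eq i

/-- `b₂ ∈ N₁ = ⟪a₁,b₂,a₃⟫` but `b₂ ∉ N₀ = ⟪a₁,a₂,b₃⟫`; hence `N₀ ≠ N₁`. [folklore] -/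
theorem s4Kernels_zero_ne_one : s4Kernels 0 ≠ s4Kernels 1 := by
  intro h
  have hb : (PresentedGroup.of ((1 : Fin 3), true) : SurfaceGroup 3) ∈ s4Kernels 1 :=
    of_mem_s4Kernels 1 (by decide)
  rw [← h, s4Kernels_eq_genKernel] at hb
  exact of_not_mem_genKernel (s4Gens_hits 0) (by decide) hb


/-! ## §0''' Rank of a finitely generated free group is an isomorphism invariant -/

/-- `F_m ≅ F_n → m = n`, by counting homomorphisms to `ℤ/2`. [folklore] -/
theorem freeGroup_rank_eq {m n : ℕ} (e : FreeGroup (Fin m) ≃* FreeGroup (Fin n)) : m = n := by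
  have key : (Fin m → Multiplicative (ZMod 2)) ≃ (Fin n → Multiplicative (ZMod 2)) :=
    FreeGroup.lift.trans ((MulEquiv.monoidHomCongrLeftEquiv e).trans FreeGroup.lift.symm)
  have h := Fintype.card_congr key
  simp only [Fintype.card_fun, Fintype.card_fin, Fintype.card_multiplicative, ZMod.card] at h
  exact Nat.pow_right_injective le_rfl h

/-- The rank in `IsFreeOfRank` is well defined. [folklore] -/
theorem IsFreeOfRank.rank_eq {H : Type*} [Group H] {m n : ℕ} (hm : IsFreeOfRank H m)
    (hn : IsFreeOfRank H n) : m = n := by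
  obtain ⟨em⟩ := hm
  obtain ⟨en⟩ := hn
  exact freeGroup_rank_eq (em.trans en.symm)

/-! ## §A Load-bearing hypotheses (`_false_without_`) — genus 3, `m = 0` witnesses -/

/-- `{a₁, a₂, a₃}`. [folklore] -/
def aGens : Finset (surfaceGen 3) := {((0 : Fin 3), false), ((1 : Fin 3), false), ((2 : Fin 3), false)}

/-- `{b₁, b₂, b₃}`. [folklore] -/
def bGens : Finset (surfaceGen 3) := {((0 : Fin 3), true), ((1 : Fin 3), true), ((2 : Fin 3), true)}

/-- `{a₁, a₂, a₃, bᵢ}`. [folklore] -/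
def abGens (i : Fin 3) : Finset (surfaceGen 3) :=
  {((0 : Fin 3), false), ((1 : Fin 3), false), ((2 : Fin 3), false), (i, true)}

/-- Generator sets of the witness `(⟪a⟫, ⟪a⟫, ⟪b⟫)`. [folklore] -/
def aabGens : Fin 3 → Finset (surfaceGen 3) := ![aGens, aGens, bGens]

/-- `{a₁,a₂,a₃}` meets every handle. [folklore] -/
theorem aGens_hits (k : Fin 3) : (k, false) ∈ aGens ∨ (k, true) ∈ aGens := by
  fin_cases k <;> decide

/-- `{b₁,b₂,b₃}` meets every handle. [folklore] -/
theorem bGens_hits (k : Fin 3) : (k, false) ∈ bGens ∨ (k, true) ∈ bGens := by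
  fin_cases k <;> decide

/-- `{a₁,a₂,a₃,bᵢ}` meets every handle. [folklore] -/
theorem abGens_hits (i k : Fin 3) : (k, false) ∈ abGens i ∨ (k, true) ∈ abGens i := by
  fin_cases i <;> fin_cases k <;> decide

/-- Each generator set of the witness `(⟪a⟫,⟪a⟫,⟪b⟫)` meets every handle. [folklore] -/
theorem aabGens_hits (i k : Fin 3) : (k, false) ∈ aabGens i ∨ (k, true) ∈ aabGens i := by
  fin_cases i <;> fin_cases k <;> decide

/-- The generator sets of `(⟪a⟫,⟪a⟫,⟪b⟫)` cover all generators. [folklore] -/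
theorem aabGens_cover (x : surfaceGen 3) : ∃ i, x ∈ aabGens i := by
  obtain ⟨k, b⟩ := x
  fin_cases k <;> cases b <;> first | exact ⟨0, by decide⟩ | exact ⟨2, by decide⟩

/-- The generator sets `{a₁,a₂,a₃,bᵢ}` cover all generators. [folklore] -/
theorem abGens_cover (x : surfaceGen 3) : ∃ i, x ∈ abGens i := by
  obtain ⟨k, b⟩ := x
  fin_cases k <;> cases b <;> first | exact ⟨0, by decide⟩ | exact ⟨1, by decide⟩ | exact ⟨2, by decide⟩

/-- Three generators survive `{a₁,a₂,a₃}`. [folklore] -/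
theorem card_compl_aGens : Fintype.card {x // x ∉ aGens} = 3 := by decide
/-- Three generators survive `{b₁,b₂,b₃}`. [folklore] -/
theorem card_compl_bGens : Fintype.card {x // x ∉ bGens} = 3 := by decide
/-- Two generators survive `{a₁,a₂,a₃,bᵢ}`. [folklore] -/
theorem card_compl_abGens (i : Fin 3) : Fintype.card {x // x ∉ abGens i} = 2 := by
  fin_cases i <;> decide
/-- One generator survives `{a₁,a₂,a₃,bᵢ,bⱼ}` for `i ≠ j`. [folklore] -/
theorem card_compl_abGens_union (i j : Fin 3) (hij : i ≠ j) :
    Fintype.card {x // x ∉ abGens i ∪ abGens j} = 1 := by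
  fin_cases i <;> fin_cases j <;> first | exact absurd rfl hij | decide

/-- The witness kernel triple `(⟪a₁,a₂,a₃⟫, ⟪a₁,a₂,a₃⟫, ⟪b₁,b₂,b₃⟫)` in `S_3`. [folklore] -/
def witnessAAB : TrisectionKernels 3 := fun i => genKernel (aabGens i)

/-- The witness kernel triple `Kᵢ = ⟪a₁,a₂,a₃,bᵢ⟫` in `S_3`. [folklore] -/
def witnessAB : TrisectionKernels 3 := fun i => genKernel (abGens i)

/-- The crux with the hypothesis `free_pairQuotient` DROPPED (all other fields of
`IsGroupTrisection` kept). [folklore] -/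
def WaldhausenPairsWithoutPairFree : Prop :=
  ∀ (m : ℕ) (K : TrisectionKernels (3 + 3 * m)),
    (∀ i, (K i).Normal) →
    (∀ i, IsFreeOfRank (SurfaceGroup (3 + 3 * m) ⧸
      normalClosure (K i : Set (SurfaceGroup (3 + 3 * m)))) (3 + 3 * m)) →
    Nonempty (K.tripleQuotient ≃* (PUnit : Type)) →
    ∀ i j : Fin 3, i ≠ j → ∃ α : SurfaceGroup (3 + 3 * m) ≃* SurfaceGroup (3 + 3 * m),
      (s4Kernels.stabilizeIter m i).map α.toMonoidHom = K i ∧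
      (s4Kernels.stabilizeIter m j).map α.toMonoidHom = K j

/-- LOAD-BEARING: without pair-freeness the crux is false. Witness `m = 0`,
`K = (⟪a₁,a₂,a₃⟫, ⟪a₁,a₂,a₃⟫, ⟪b₁,b₂,b₃⟫)`: normal, single quotients `F_3`, triple quotient
trivial, but `K₀ = K₁` cannot be `(α N₀, α N₁)` since `N₀ ≠ N₁`. (Its pair quotients are `F_3`
and `1`, not `F_1`.) Any proof must use the pairwise pushout, i.e. the 3-manifold `Hᵢ ∪ Hⱼ`.
[folklore] -/
theorem waldhausenPairs_false_without_pairFree : ¬ WaldhausenPairsWithoutPairFree := by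
  intro h
  have hfree : ∀ i, IsFreeOfRank (SurfaceGroup 3 ⧸
      normalClosure (witnessAAB i : Set (SurfaceGroup 3))) 3 := by
    intro i
    fin_cases i
    · exact isFreeOfRank_quot_genKernel aGens aGens_hits card_compl_aGens
    · exact isFreeOfRank_quot_genKernel aGens aGens_hits card_compl_aGens
    · exact isFreeOfRank_quot_genKernel bGens bGens_hits card_compl_bGens
  obtain ⟨α, h0, h1⟩ := h 0 witnessAAB (fun i => genKernel_normal _) hfree
    (tripleQuotient_trivial aabGens aabGens_cover) 0 1 (by decide)
  apply s4Kernels_zero_ne_one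
  apply Subgroup.map_injective (f := α.toMonoidHom) (by exact α.injective)
  change (s4Kernels.stabilizeIter 0 0).map α.toMonoidHom = (s4Kernels.stabilizeIter 0 1).map α.toMonoidHom
  rw [h0, h1]
  rfl

/-- The crux with the hypothesis `free_quotient` DROPPED (all other fields kept). [folklore] -/
def WaldhausenPairsWithoutFreeQuotient : Prop :=
  ∀ (m : ℕ) (K : TrisectionKernels (3 + 3 * m)),
    (∀ i, (K i).Normal) →
    (∀ i j, i ≠ j → IsFreeOfRank (K.pairQuotient i j) (m + 1)) →
    Nonempty (K.tripleQuotient ≃* (PUnit : Type)) →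
    ∀ i j : Fin 3, i ≠ j → ∃ α : SurfaceGroup (3 + 3 * m) ≃* SurfaceGroup (3 + 3 * m),
      (s4Kernels.stabilizeIter m i).map α.toMonoidHom = K i ∧
      (s4Kernels.stabilizeIter m j).map α.toMonoidHom = K j

/-- LOAD-BEARING: without rank-`g` freeness of the single quotients the crux is false.
Witness `m = 0`, `Kᵢ = ⟪a₁,a₂,a₃,bᵢ⟫`: normal, pair quotients `F_1` (one surviving `b`), triple
quotient trivial, but `S_3/K₀ ≅ F_2 ≄ F_3 ≅ S_3/N₀`, so no automorphism carries `N₀` to `K₀`.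
Any proof must use that `S_g/Kᵢ` is free of rank exactly `g` (Leininger–Reid 2002 Lemma 2.2 /
Jaco 1969: epimorphisms `S_g ↠ F_g` are geometric). [folklore] -/
theorem waldhausenPairs_false_without_freeQuotient : ¬ WaldhausenPairsWithoutFreeQuotient := by
  intro h
  have hpair : ∀ i j : Fin 3, i ≠ j → IsFreeOfRank (witnessAB.pairQuotient i j) (0 + 1) :=
    fun i j hij => isFreeOfRank_quot_genKernel_pair (abGens i) (abGens j) (abGens_hits i)
      (card_compl_abGens_union i j hij)
  obtain ⟨α, h0, -⟩ := h 0 witnessAB (fun i => genKernel_normal _) hpair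
    (tripleQuotient_trivial abGens abGens_cover) 0 1 (by decide)
  have h0' : (s4Kernels 0).map (α : SurfaceGroup 3 →* SurfaceGroup 3) = genKernel (abGens 0) := h0
  -- `S_3 / N₀ ≅ S_3 / K₀`, transported to the `normalClosure` forms used by `IsFreeOfRank`
  have e : SurfaceGroup 3 ⧸ normalClosure ((s4Kernels 0 : Subgroup (SurfaceGroup 3)) :
        Set (SurfaceGroup 3)) ≃*
      SurfaceGroup 3 ⧸ normalClosure ((genKernel (abGens 0) : Subgroup (SurfaceGroup 3)) :
        Set (SurfaceGroup 3)) := by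
    haveI : (s4Kernels 0).Normal := s4Kernels_isGroupTrisection_holds.normal 0
    exact ((QuotientGroup.quotientMulEquivOfEq (normalClosure_eq_self _)).trans
      (QuotientGroup.congr (s4Kernels 0) (genKernel (abGens 0)) α h0')).trans
      (QuotientGroup.quotientMulEquivOfEq (normalClosure_eq_self _).symm)
  have h3 : IsFreeOfRank (SurfaceGroup 3 ⧸ normalClosure ((genKernel (abGens 0) :
      Subgroup (SurfaceGroup 3)) : Set (SurfaceGroup 3))) 3 :=
    (s4Kernels_isGroupTrisection_holds.free_quotient 0).of_mulEquiv e
  have h2 : IsFreeOfRank (SurfaceGroup 3 ⧸ normalClosure ((genKernel (abGens 0) :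
      Subgroup (SurfaceGroup 3)) : Set (SurfaceGroup 3))) 2 :=
    isFreeOfRank_quot_genKernel (abGens 0) (abGens_hits 0) (card_compl_abGens 0)
  exact absurd (IsFreeOfRank.rank_eq h3 h2) (by decide)

/-- Corollary: with the whole hypothesis `IsGroupTrisection` dropped the statement is false
(the hypothesis is not decoration). [folklore] -/
theorem waldhausenPairs_false_without_hypothesis :
    ¬ ∀ (m : ℕ) (K : TrisectionKernels (3 + 3 * m)) (i j : Fin 3), i ≠ j →
      ∃ α : SurfaceGroup (3 + 3 * m) ≃* SurfaceGroup (3 + 3 * m),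
        (s4Kernels.stabilizeIter m i).map α.toMonoidHom = K i ∧
        (s4Kernels.stabilizeIter m j).map α.toMonoidHom = K j :=
  fun h => waldhausenPairs_false_without_pairFree fun m K _ _ _ i j hij => h m K i j hij


/-! ## §A' Load-bearing hypotheses (2): normality — genus 3, `m = 0` witness (cycle 2) -/

/-- Generator images of a representation `ρ : S_3 → Sym(3)`: `a₁ ↦ (0 1)`, `b₁ ↦ (0 2)`,
`a₂, b₂ ↦ 1`, `a₃ ↦ (0 2)`, `b₃ ↦ (0 1)` (so `[ρa₁,ρb₁][ρa₂,ρb₂][ρa₃,ρb₃] = [s,t]·1·[t,s] = 1`).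
[folklore] -/
def permGen (x : surfaceGen 3) : Equiv.Perm (Fin 3) :=
  if x = ((0 : Fin 3), false) then Equiv.swap 0 1
  else if x = ((0 : Fin 3), true) then Equiv.swap 0 2
  else if x = ((2 : Fin 3), false) then Equiv.swap 0 2
  else if x = ((2 : Fin 3), true) then Equiv.swap 0 1
  else 1

/-- `ρ` kills the surface relator (kernel computation in `Sym(3)`). [folklore] -/
theorem lift_permGen_surfaceRelator : FreeGroup.lift permGen (surfaceRelator 3) = 1 := by
  decide

/-- The representation `ρ : S_3 → Sym(3)`. [folklore] -/
def permHom : SurfaceGroup 3 →* Equiv.Perm (Fin 3) :=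
  presentedLift (FreeGroup.lift permGen) (by
    intro r hr
    rw [Set.mem_singleton_iff] at hr
    subst hr
    exact lift_permGen_surfaceRelator)

/-- `ρ` on `aᵢ`. [folklore] -/
theorem permHom_a (i : Fin 3) : permHom (SurfaceGroup.a i) = permGen (i, false) := by
  simp [permHom, SurfaceGroup.a]

/-- `ρ` on `bᵢ`. [folklore] -/
theorem permHom_b (i : Fin 3) : permHom (SurfaceGroup.b i) = permGen (i, true) := by
  simp [permHom, SurfaceGroup.b]

/-- The subgroup GENERATED (not normally generated) by `a₁, a₂, b₃`. [folklore] -/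
def badK0 : Subgroup (SurfaceGroup 3) :=
  Subgroup.closure {SurfaceGroup.a 0, SurfaceGroup.a 1, SurfaceGroup.b 2}

/-- `ρ(⟨a₁, a₂, b₃⟩)` fixes the point `2`. [folklore] -/
theorem map_permHom_badK0_le :
    badK0.map permHom ≤ MulAction.stabilizer (Equiv.Perm (Fin 3)) (2 : Fin 3) := by
  rw [badK0, MonoidHom.map_closure, Subgroup.closure_le]
  rintro _ ⟨x, hx, rfl⟩
  simp only [Set.mem_insert_iff, Set.mem_singleton_iff] at hx
  rw [SetLike.mem_coe, MulAction.mem_stabilizer_iff]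
  rcases hx with rfl | rfl | rfl
  · rw [permHom_a]; decide
  · rw [permHom_a]; decide
  · rw [permHom_b]; decide

/-- `⟨a₁, a₂, b₃⟩ ≤ S_3` is NOT normal: `ρ(b₁ a₁ b₁⁻¹) = (1 2)` moves `2`. [folklore] -/
theorem badK0_not_normal : ¬ (badK0).Normal := by
  intro hN
  have hmem : SurfaceGroup.b 0 * SurfaceGroup.a 0 * (SurfaceGroup.b 0)⁻¹ ∈ badK0 :=
    hN.conj_mem _ (Subgroup.subset_closure (by simp)) _
  have h2 := map_permHom_badK0_le (Subgroup.mem_map_of_mem permHom hmem)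
  rw [MulAction.mem_stabilizer_iff, map_mul, map_mul, map_inv, permHom_a, permHom_b] at h2
  revert h2
  decide

/-- The witness: slot `0` is the non-normal `⟨a₁,a₂,b₃⟩`, slots `1, 2` are standard. [folklore] -/
def badK : TrisectionKernels 3 := ![badK0, s4Kernels 1, s4Kernels 2]

/-- Normal closures of unions only see normal closures of the parts. [folklore] -/
theorem normalClosure_union_congr {G : Type*} [Group G] {A A' B B' : Set G}
    (hA : normalClosure A = normalClosure A') (hB : normalClosure B = normalClosure B') :
    normalClosure (A ∪ B) = normalClosure (A' ∪ B') := by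
  have key : ∀ {A A' B B' : Set G}, normalClosure A ≤ normalClosure A' →
      normalClosure B ≤ normalClosure B' → normalClosure (A ∪ B) ≤ normalClosure (A' ∪ B') := by
    intro A A' B B' hA hB
    refine normalClosure_le_normal (Set.union_subset ?_ ?_)
    · exact fun x hx => normalClosure_mono Set.subset_union_left (hA (subset_normalClosure hx))
    · exact fun x hx => normalClosure_mono Set.subset_union_right (hB (subset_normalClosure hx))
  exact le_antisymm (key hA.le hB.le) (key hA.ge hB.ge)

/-- Same for indexed unions. [folklore] -/
theorem normalClosure_iUnion_congr {G : Type*} [Group G] {ι : Sort*} {A A' : ι → Set G}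
    (h : ∀ i, normalClosure (A i) = normalClosure (A' i)) :
    normalClosure (⋃ i, A i) = normalClosure (⋃ i, A' i) := by
  have key : ∀ {A A' : ι → Set G}, (∀ i, normalClosure (A i) ≤ normalClosure (A' i)) →
      normalClosure (⋃ i, A i) ≤ normalClosure (⋃ i, A' i) := by
    intro A A' hA
    refine normalClosure_le_normal (Set.iUnion_subset fun i => ?_)
    exact fun x hx => normalClosure_mono (Set.subset_iUnion _ i) (hA i (subset_normalClosure hx))
  exact le_antisymm (key fun i => (h i).le) (key fun i => (h i).ge)

/-- Slot by slot, the witness has the same normal closures as the standard triple. [folklore] -/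
theorem normalClosure_badK (i : Fin 3) :
    normalClosure ((badK i : Subgroup (SurfaceGroup 3)) : Set (SurfaceGroup 3)) =
      normalClosure ((s4Kernels i : Subgroup (SurfaceGroup 3)) : Set (SurfaceGroup 3)) := by
  haveI : ∀ j, (s4Kernels j).Normal := s4Kernels_isGroupTrisection_holds.normal
  fin_cases i
  · have h0 : s4Kernels 0 = normalClosure {SurfaceGroup.a 0, SurfaceGroup.a 1, SurfaceGroup.b 2} := rfl
    change normalClosure ((badK0 : Subgroup (SurfaceGroup 3)) : Set (SurfaceGroup 3)) =
      normalClosure ((s4Kernels 0 : Subgroup (SurfaceGroup 3)) : Set (SurfaceGroup 3))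
    rw [normalClosure_eq_self (s4Kernels 0), h0, badK0, normalClosure_closure_eq_normalClosure]
  · rfl
  · rfl

/-- The crux with the hypothesis `normal` DROPPED (all other fields of `IsGroupTrisection` kept
verbatim). [folklore] -/
def WaldhausenPairsWithoutNormal : Prop :=
  ∀ (m : ℕ) (K : TrisectionKernels (3 + 3 * m)),
    (∀ i, IsFreeOfRank (SurfaceGroup (3 + 3 * m) ⧸
      normalClosure (K i : Set (SurfaceGroup (3 + 3 * m)))) (3 + 3 * m)) →
    (∀ i j, i ≠ j → IsFreeOfRank (K.pairQuotient i j) (m + 1)) →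
    Nonempty (K.tripleQuotient ≃* (PUnit : Type)) →
    ∀ i j : Fin 3, i ≠ j → ∃ α : SurfaceGroup (3 + 3 * m) ≃* SurfaceGroup (3 + 3 * m),
      (s4Kernels.stabilizeIter m i).map α.toMonoidHom = K i ∧
      (s4Kernels.stabilizeIter m j).map α.toMonoidHom = K j

/-- LOAD-BEARING (normality): with `normal` dropped the crux is FALSE.  Witness `m = 0`,
`K = (⟨a₁,a₂,b₃⟩, N₁, N₂)` with slot `0` the subgroup GENERATED by `a₁, a₂, b₃` (not its normal
closure `N₀`): every quotient condition of `IsGroupTrisection` only sees normal closures, so `K`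
has exactly the seven quotients of `N`, but `α(N₀) = K₀` is impossible because `α(N₀)` is normal
and `⟨a₁,a₂,b₃⟩` is not (`badK0_not_normal`, via `ρ : S_3 → Sym(3)`).  Moral for provers: the
conclusion `(N i).map α = K i` silently re-asserts normality of `K i`; the quotient data never
do, so `hK.normal i`, `hK.normal j` must be fed to the realisation step (they are: S1 of every
line takes `A.Normal`, `B.Normal`).  This completes the load-bearing table of the four fields of
`IsGroupTrisection`: `normal` ✓ (here), `free_quotient` ✓, `free_pairQuotient` ✓ (§A),
`triple` ✗ (never needed, §C). [folklore] -/
theorem waldhausenPairs_false_without_normal : ¬ WaldhausenPairsWithoutNormal := by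
  intro h
  have hN := s4Kernels_isGroupTrisection_holds
  have hfree : ∀ i, IsFreeOfRank (SurfaceGroup 3 ⧸
      normalClosure ((badK i : Subgroup (SurfaceGroup 3)) : Set (SurfaceGroup 3))) 3 := fun i =>
    (hN.free_quotient i).of_mulEquiv (QuotientGroup.quotientMulEquivOfEq (normalClosure_badK i).symm)
  have hpair : ∀ i j : Fin 3, i ≠ j → IsFreeOfRank (badK.pairQuotient i j) (0 + 1) := fun i j hij =>
    (hN.free_pairQuotient i j hij).of_mulEquiv (QuotientGroup.quotientMulEquivOfEq
      (normalClosure_union_congr (normalClosure_badK i).symm (normalClosure_badK j).symm))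
  have htriple : Nonempty (badK.tripleQuotient ≃* (PUnit : Type)) := by
    obtain ⟨e⟩ := hN.triple
    exact ⟨(QuotientGroup.quotientMulEquivOfEq
      (normalClosure_iUnion_congr fun i => (normalClosure_badK i).symm)).symm.trans e⟩
  obtain ⟨α, h0, -⟩ := h 0 badK hfree hpair htriple 0 1 (by decide)
  have h0' : (s4Kernels 0).map (α : SurfaceGroup 3 →* SurfaceGroup 3) = badK0 := h0
  have hn : (badK0).Normal := by
    rw [← h0']
    exact Subgroup.Normal.map (hN.normal 0) _ α.surjective
  exact badK0_not_normal hn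

/-! ### Remark on the §A witness `(⟪a⟫,⟪a⟫,⟪b⟫)`

It is not an artefact: `witnessAAB = (⟪a₁,a₂,a₃⟫, ⟪a₁,a₂,a₃⟫, ⟪b₁,b₂,b₃⟫)` is the kernel triple
of the UNBALANCED `(3; 3,0,0)` trisection of `S⁴` (the connected sum of three copies of the
genus-`1` unbalanced trisection `unbalancedKernels 2 = (⟪a⟫,⟪a⟫,⟪b⟫)` of
`GroupTrisectionsConnectSum.lean`): a genuine trisection of `S⁴` whose `(0,1)` pair is a genus-3
splitting of `#³ S¹×S²`, not of `S¹×S²`.  So `free_pairQuotient` is load-bearing through the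
VALUE `m+1` of the pair rank (balancedness), not merely through freeness. -/

/-! ## §B A refuted natural strengthening: stabilisers do not transfer (`m = 0`, `K = N`) -/

/-- Generator images of the transvection `τ : b₂ ↦ b₂ a₂` (0-indexed handle `1`; a Dehn twist
about `a₂`), on the free group. [folklore] -/
def twistGen (x : surfaceGen 3) : FreeGroup (surfaceGen 3) :=
  if x = ((1 : Fin 3), true) then FreeGroup.of ((1 : Fin 3), true) * FreeGroup.of ((1 : Fin 3), false)
  else FreeGroup.of x

/-- Generator images of `τ⁻¹ : b₂ ↦ b₂ a₂⁻¹`. [folklore] -/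
def untwistGen (x : surfaceGen 3) : FreeGroup (surfaceGen 3) :=
  if x = ((1 : Fin 3), true) then FreeGroup.of ((1 : Fin 3), true) * (FreeGroup.of ((1 : Fin 3), false))⁻¹
  else FreeGroup.of x

/-- `τ` fixes each commutator `[aᵢ, bᵢ]` in the free group. [folklore] -/
theorem lift_twistGen_comm (i : Fin 3) :
    FreeGroup.lift twistGen (genA i * genB i * (genA i)⁻¹ * (genB i)⁻¹) =
      genA i * genB i * (genA i)⁻¹ * (genB i)⁻¹ := by
  fin_cases i
  · simp [twistGen, genA, genB]
  · simp only [twistGen, genA, genB, map_mul, map_inv, FreeGroup.lift_apply_of]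
    simp
    group
  · simp [twistGen, genA, genB]

/-- `τ⁻¹` fixes each commutator `[aᵢ, bᵢ]` in the free group. [folklore] -/
theorem lift_untwistGen_comm (i : Fin 3) :
    FreeGroup.lift untwistGen (genA i * genB i * (genA i)⁻¹ * (genB i)⁻¹) =
      genA i * genB i * (genA i)⁻¹ * (genB i)⁻¹ := by
  fin_cases i
  · simp [untwistGen, genA, genB]
  · simp only [untwistGen, genA, genB, map_mul, map_inv, FreeGroup.lift_apply_of]
    simp
    group
  · simp [untwistGen, genA, genB]

/-- `τ` fixes the surface relator (already in the free group). [folklore] -/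
theorem lift_twistGen_surfaceRelator :
    FreeGroup.lift twistGen (surfaceRelator 3) = surfaceRelator 3 := by
  unfold surfaceRelator
  rw [map_list_prod, List.map_map]
  exact congrArg List.prod (List.map_congr_left fun i _ => lift_twistGen_comm i)

/-- `τ⁻¹` fixes the surface relator. [folklore] -/
theorem lift_untwistGen_surfaceRelator :
    FreeGroup.lift untwistGen (surfaceRelator 3) = surfaceRelator 3 := by
  unfold surfaceRelator
  rw [map_list_prod, List.map_map]
  exact congrArg List.prod (List.map_congr_left fun i _ => lift_untwistGen_comm i)

/-- The transvection `τ` as an endomorphism of `S_3`. [folklore] -/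
def twistHom : SurfaceGroup 3 →* SurfaceGroup 3 :=
  presentedLift ((PresentedGroup.mk _).comp (FreeGroup.lift twistGen)) (by
    intro r hr
    rw [Set.mem_singleton_iff] at hr
    subst hr
    rw [MonoidHom.comp_apply, lift_twistGen_surfaceRelator]
    exact PresentedGroup.one_of_mem (Set.mem_singleton _))

/-- `τ⁻¹` as an endomorphism of `S_3`. [folklore] -/
def untwistHom : SurfaceGroup 3 →* SurfaceGroup 3 :=
  presentedLift ((PresentedGroup.mk _).comp (FreeGroup.lift untwistGen)) (by
    intro r hr
    rw [Set.mem_singleton_iff] at hr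
    subst hr
    rw [MonoidHom.comp_apply, lift_untwistGen_surfaceRelator]
    exact PresentedGroup.one_of_mem (Set.mem_singleton _))

/-- `τ` on the class of a word. [folklore] -/
@[simp] theorem twistHom_mk (w : FreeGroup (surfaceGen 3)) :
    twistHom (PresentedGroup.mk _ w) = PresentedGroup.mk _ (FreeGroup.lift twistGen w) := by
  simp [twistHom]

/-- `τ⁻¹` on the class of a word. [folklore] -/
@[simp] theorem untwistHom_mk (w : FreeGroup (surfaceGen 3)) :
    untwistHom (PresentedGroup.mk _ w) = PresentedGroup.mk _ (FreeGroup.lift untwistGen w) := by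
  simp [untwistHom]

/-- The transvection `τ : b₂ ↦ b₂a₂` as an automorphism of `S_3` (a Dehn twist). [folklore] -/
def twistEquiv : SurfaceGroup 3 ≃* SurfaceGroup 3 :=
  MonoidHom.toMulEquiv twistHom untwistHom
    (PresentedGroup.ext fun x => by
      obtain ⟨k, b⟩ := x
      fin_cases k <;> cases b <;> simp [twistGen, untwistGen, PresentedGroup.of])
    (PresentedGroup.ext fun x => by
      obtain ⟨k, b⟩ := x
      fin_cases k <;> cases b <;> simp [twistGen, untwistGen, PresentedGroup.of])

/-- `τ` fixes every `aᵢ`. [folklore] -/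
theorem twistEquiv_a (i : Fin 3) : twistEquiv (SurfaceGroup.a i) = SurfaceGroup.a i := by
  fin_cases i <;> simp [twistEquiv, SurfaceGroup.a, twistGen, PresentedGroup.of]

/-- `τ` fixes `b₁`. [folklore] -/
theorem twistEquiv_b_zero : twistEquiv (SurfaceGroup.b 0) = SurfaceGroup.b 0 := by
  simp [twistEquiv, SurfaceGroup.b, twistGen, PresentedGroup.of]

/-- `τ` fixes `b₃`. [folklore] -/
theorem twistEquiv_b_two : twistEquiv (SurfaceGroup.b 2) = SurfaceGroup.b 2 := by
  simp [twistEquiv, SurfaceGroup.b, twistGen, PresentedGroup.of]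

/-- `τ b₂ = b₂ a₂`. [folklore] -/
theorem twistEquiv_b_one :
    twistEquiv (SurfaceGroup.b 1) = SurfaceGroup.b 1 * SurfaceGroup.a 1 := by
  simp [twistEquiv, SurfaceGroup.b, SurfaceGroup.a, twistGen, PresentedGroup.of]

/-- `τ` stabilises `N₀ = ⟪a₁, a₂, b₃⟫`. [folklore] -/
theorem map_twist_s4Kernels_zero :
    (s4Kernels 0).map twistEquiv.toMonoidHom = s4Kernels 0 := by
  have h0 : s4Kernels 0 = normalClosure {SurfaceGroup.a 0, SurfaceGroup.a 1, SurfaceGroup.b 2} := rfl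
  rw [h0, map_normalClosure _ twistEquiv.toMonoidHom (by exact twistEquiv.surjective)]
  congr 1
  simp [Set.image_insert_eq, Set.image_singleton, twistEquiv_a, twistEquiv_b_two]

/-- … but `τ` moves `N₁ = ⟪a₁, b₂, a₃⟫`: `τ(b₂) = b₂a₂ ∈ τ(N₁)` while `b₂a₂ ∉ N₁` (erase
`{a₁,b₂,a₃}`: `b₂a₂ ↦ a₂ ≠ 1`). [folklore] -/
theorem map_twist_s4Kernels_one_ne :
    (s4Kernels 1).map twistEquiv.toMonoidHom ≠ s4Kernels 1 := by
  intro h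
  have hmem : SurfaceGroup.b 1 * SurfaceGroup.a 1 ∈ s4Kernels 1 := by
    rw [← h, ← twistEquiv_b_one]
    exact Subgroup.mem_map_of_mem _ (of_mem_s4Kernels 1 (x := ((1 : Fin 3), true)) (by decide))
  have hker := s4Kernels_le_ker (s4Gens 1) (s4Gens_hits 1) 1 le_rfl hmem
  rw [MonoidHom.mem_ker, map_mul] at hker
  change eraseHom _ _ (PresentedGroup.of _) * eraseHom _ _ (PresentedGroup.of _) = 1 at hker
  rw [eraseHom_of, eraseHom_of, eraseGen_of_mem (by decide),
    eraseGen_of_not_mem (by decide), one_mul] at hker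
  exact FreeGroup.of_ne_one _ hker

/-- NATURAL STRENGTHENING (false): "an automorphism standardising `Kᵢ` also standardises `Kⱼ`",
i.e. uniqueness of `α` modulo nothing / stabilisers transfer between the two handlebody
kernels. [folklore] -/
def PairTransfer : Prop :=
  ∀ (m : ℕ) (K : TrisectionKernels (3 + 3 * m)),
    IsGroupTrisection (3 + 3 * m) (m + 1) (PUnit : Type) K →
    ∀ i j : Fin 3, i ≠ j → ∀ α : SurfaceGroup (3 + 3 * m) ≃* SurfaceGroup (3 + 3 * m),
      (s4Kernels.stabilizeIter m i).map α.toMonoidHom = K i →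
      (s4Kernels.stabilizeIter m j).map α.toMonoidHom = K j

/-- REFUTED STRENGTHENING: `PairTransfer` fails already for `S⁴` itself (`m = 0`, `K = N`,
`α = τ` the Dehn twist `b₂ ↦ b₂a₂`: `τ N₀ = N₀`, `τ N₁ ≠ N₁`). Moral for provers: the stabiliser
of one handlebody kernel (a handlebody group) is not inside the stabiliser of the other, so the
two single-kernel standardisations (Leininger–Reid) cannot be chained; the simultaneous `α` is
Waldhausen's theorem on the Heegaard splitting `Hᵢ ∪ Hⱼ ≅ #ᵏ S¹×S²`. [folklore] -/
theorem not_pairTransfer : ¬ PairTransfer := fun h =>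
  map_twist_s4Kernels_one_ne
    (h 0 s4Kernels s4Kernels_isGroupTrisection_holds 0 1 (by decide) twistEquiv
      map_twist_s4Kernels_zero)

/-! ## §B' The hypothesis is an `Aut(S_g)`-invariant condition; it does not pin `K` (not rigid) -/

section transport

variable {g' k : ℕ} {G : Type*} [Group G]

/-- Images of the generators of a normal closure generate the image (for a surjection).
[folklore] -/
theorem map_normalClosure_coe (α : SurfaceGroup g' ≃* SurfaceGroup g') (s : Set (SurfaceGroup g')) :
    (normalClosure s).map (α : SurfaceGroup g' →* SurfaceGroup g') = normalClosure (α '' s) := by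
  rw [map_normalClosure _ _ (by exact α.surjective)]
  rfl

/-- TRANSPORT: the trisection property is invariant under automorphisms of `S_g`
(`K ↦ α • K`); in particular the set of `K` satisfying the hypothesis of the crux is a union of
`Aut(S_g)`-orbits containing the orbit of `N`. [cite: AbramsGayKirby2018, §2] -/
theorem IsGroupTrisection.map_mulEquiv {K : TrisectionKernels g'} (hK : IsGroupTrisection g' k G K)
    (α : SurfaceGroup g' ≃* SurfaceGroup g') :
    IsGroupTrisection g' k G (fun i => (K i).map α.toMonoidHom) := by
  have hsurj : Function.Surjective α.toMonoidHom := α.surjective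
  refine ⟨fun i => Subgroup.Normal.map (hK.normal i) _ hsurj, fun i => ?_, fun i j hij => ?_, ?_⟩
  · refine (hK.free_quotient i).of_mulEquiv (QuotientGroup.congr _ _ α ?_)
    rw [map_normalClosure_coe]
    simp [Subgroup.coe_map]
  · refine (hK.free_pairQuotient i j hij).of_mulEquiv (QuotientGroup.congr _ _ α ?_)
    rw [map_normalClosure_coe]
    simp [Subgroup.coe_map, Set.image_union]
  · obtain ⟨e⟩ := hK.triple
    refine ⟨(QuotientGroup.congr _ _ α ?_).symm.trans e⟩
    rw [map_normalClosure_coe]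
    simp [Subgroup.coe_map, Set.image_iUnion]

end transport

/-- NOT RIGID (refuted strengthening "`α = 1` suffices pairwise"): `τ • N` (the image of the
standard genus-3 triple under the Dehn twist `τ`) is a `(3,1)` group trisection of the trivial
group with `(τ•N)₀ = N₀` but `(τ•N)₁ ≠ N₁`. So the hypothesis does not determine `K_j` from
`K_i`, the `∃ α` genuinely ranges over `Aut(S_g)`, and inner automorphisms never suffice
(they fix normal subgroups). [folklore] -/
theorem not_rigid :
    ¬ ∀ (m : ℕ) (K : TrisectionKernels (3 + 3 * m)),
      IsGroupTrisection (3 + 3 * m) (m + 1) (PUnit : Type) K →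
      ∀ i j : Fin 3, i ≠ j → s4Kernels.stabilizeIter m i = K i → s4Kernels.stabilizeIter m j = K j := by
  intro h
  have hK := IsGroupTrisection.map_mulEquiv s4Kernels_isGroupTrisection_holds twistEquiv
  exact map_twist_s4Kernels_one_ne
    (h 0 _ hK 0 1 (by decide) map_twist_s4Kernels_zero.symm).symm

/-! ## §B'' Ordered = unordered at `m = 0`: the standard pair has a side swap -/

/-- Generator images of the side swap `σ`: identity on the shared handle `0`, the half-twist
`φ = T_a T_b⁻¹ T_a : a ↦ b⁻¹, b ↦ b a b⁻¹` (which fixes `[a,b]` letter for letter) on handles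
`1, 2`. [folklore] -/
def swapGen (x : surfaceGen 3) : FreeGroup (surfaceGen 3) :=
  if x.1 = 0 then FreeGroup.of x
  else if x.2 = false then (FreeGroup.of (x.1, true))⁻¹
  else FreeGroup.of (x.1, true) * FreeGroup.of (x.1, false) * (FreeGroup.of (x.1, true))⁻¹

/-- Generator images of `σ⁻¹`: `a ↦ a b a⁻¹, b ↦ a⁻¹` on handles `1, 2`. [folklore] -/
def unswapGen (x : surfaceGen 3) : FreeGroup (surfaceGen 3) :=
  if x.1 = 0 then FreeGroup.of x
  else if x.2 = false then FreeGroup.of (x.1, false) * FreeGroup.of (x.1, true) * (FreeGroup.of (x.1, false))⁻¹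
  else (FreeGroup.of (x.1, false))⁻¹

/-- `σ` fixes each commutator `[aᵢ, bᵢ]` in the free group. [folklore] -/
theorem lift_swapGen_comm (i : Fin 3) :
    FreeGroup.lift swapGen (genA i * genB i * (genA i)⁻¹ * (genB i)⁻¹) =
      genA i * genB i * (genA i)⁻¹ * (genB i)⁻¹ := by
  fin_cases i
  · simp [swapGen, genA, genB]
  · simp only [swapGen, genA, genB, map_mul, map_inv, FreeGroup.lift_apply_of]
    simp
    group
  · simp only [swapGen, genA, genB, map_mul, map_inv, FreeGroup.lift_apply_of]
    simp
    group

/-- `σ⁻¹` fixes each commutator `[aᵢ, bᵢ]` in the free group. [folklore] -/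
theorem lift_unswapGen_comm (i : Fin 3) :
    FreeGroup.lift unswapGen (genA i * genB i * (genA i)⁻¹ * (genB i)⁻¹) =
      genA i * genB i * (genA i)⁻¹ * (genB i)⁻¹ := by
  fin_cases i
  · simp [unswapGen, genA, genB]
  · simp only [unswapGen, genA, genB, map_mul, map_inv, FreeGroup.lift_apply_of]
    simp
    group
  · simp only [unswapGen, genA, genB, map_mul, map_inv, FreeGroup.lift_apply_of]
    simp
    group

/-- `σ` fixes the surface relator. [folklore] -/
theorem lift_swapGen_surfaceRelator :
    FreeGroup.lift swapGen (surfaceRelator 3) = surfaceRelator 3 := by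
  unfold surfaceRelator
  rw [map_list_prod, List.map_map]
  exact congrArg List.prod (List.map_congr_left fun i _ => lift_swapGen_comm i)

/-- `σ⁻¹` fixes the surface relator. [folklore] -/
theorem lift_unswapGen_surfaceRelator :
    FreeGroup.lift unswapGen (surfaceRelator 3) = surfaceRelator 3 := by
  unfold surfaceRelator
  rw [map_list_prod, List.map_map]
  exact congrArg List.prod (List.map_congr_left fun i _ => lift_unswapGen_comm i)

/-- `σ` as an endomorphism of `S_3`. [folklore] -/
def swapHom : SurfaceGroup 3 →* SurfaceGroup 3 :=
  presentedLift ((PresentedGroup.mk _).comp (FreeGroup.lift swapGen)) (by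
    intro r hr
    rw [Set.mem_singleton_iff] at hr
    subst hr
    rw [MonoidHom.comp_apply, lift_swapGen_surfaceRelator]
    exact PresentedGroup.one_of_mem (Set.mem_singleton _))

/-- `σ⁻¹` as an endomorphism of `S_3`. [folklore] -/
def unswapHom : SurfaceGroup 3 →* SurfaceGroup 3 :=
  presentedLift ((PresentedGroup.mk _).comp (FreeGroup.lift unswapGen)) (by
    intro r hr
    rw [Set.mem_singleton_iff] at hr
    subst hr
    rw [MonoidHom.comp_apply, lift_unswapGen_surfaceRelator]
    exact PresentedGroup.one_of_mem (Set.mem_singleton _))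

/-- `σ` on the class of a word. [folklore] -/
@[simp] theorem swapHom_mk (w : FreeGroup (surfaceGen 3)) :
    swapHom (PresentedGroup.mk _ w) = PresentedGroup.mk _ (FreeGroup.lift swapGen w) := by
  simp [swapHom]

/-- `σ⁻¹` on the class of a word. [folklore] -/
@[simp] theorem unswapHom_mk (w : FreeGroup (surfaceGen 3)) :
    unswapHom (PresentedGroup.mk _ w) = PresentedGroup.mk _ (FreeGroup.lift unswapGen w) := by
  simp [unswapHom]

/-- The side swap `σ` as an automorphism of `S_3` (product of half-twists on handles 1, 2).
[folklore] -/
def swapEquiv : SurfaceGroup 3 ≃* SurfaceGroup 3 :=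
  MonoidHom.toMulEquiv swapHom unswapHom
    (PresentedGroup.ext fun x => by
      obtain ⟨k, b⟩ := x
      fin_cases k <;> cases b <;> simp [swapGen, unswapGen, PresentedGroup.of, mul_assoc])
    (PresentedGroup.ext fun x => by
      obtain ⟨k, b⟩ := x
      fin_cases k <;> cases b <;> simp [swapGen, unswapGen, PresentedGroup.of, mul_assoc])

/-- `σ a₁ = a₁`. [folklore] -/
theorem swapEquiv_a_zero : swapEquiv (SurfaceGroup.a 0) = SurfaceGroup.a 0 := by
  simp [swapEquiv, SurfaceGroup.a, swapGen, PresentedGroup.of]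

/-- `σ b₁ = b₁`. [folklore] -/
theorem swapEquiv_b_zero : swapEquiv (SurfaceGroup.b 0) = SurfaceGroup.b 0 := by
  simp [swapEquiv, SurfaceGroup.b, swapGen, PresentedGroup.of]

/-- `σ a₂ = b₂⁻¹`. [folklore] -/
theorem swapEquiv_a_one : swapEquiv (SurfaceGroup.a 1) = (SurfaceGroup.b 1)⁻¹ := by
  simp [swapEquiv, SurfaceGroup.a, SurfaceGroup.b, swapGen, PresentedGroup.of]

/-- `σ a₃ = b₃⁻¹`. [folklore] -/
theorem swapEquiv_a_two : swapEquiv (SurfaceGroup.a 2) = (SurfaceGroup.b 2)⁻¹ := by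
  simp [swapEquiv, SurfaceGroup.a, SurfaceGroup.b, swapGen, PresentedGroup.of]

/-- `σ b₂ = b₂ a₂ b₂⁻¹`. [folklore] -/
theorem swapEquiv_b_one :
    swapEquiv (SurfaceGroup.b 1) = SurfaceGroup.b 1 * SurfaceGroup.a 1 * (SurfaceGroup.b 1)⁻¹ := by
  simp [swapEquiv, SurfaceGroup.a, SurfaceGroup.b, swapGen, PresentedGroup.of, mul_assoc]

/-- `σ b₃ = b₃ a₃ b₃⁻¹`. [folklore] -/
theorem swapEquiv_b_two :
    swapEquiv (SurfaceGroup.b 2) = SurfaceGroup.b 2 * SurfaceGroup.a 2 * (SurfaceGroup.b 2)⁻¹ := by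
  simp [swapEquiv, SurfaceGroup.a, SurfaceGroup.b, swapGen, PresentedGroup.of, mul_assoc]

/-- Normal closures are insensitive to inverting a generator and conjugating another.
[folklore] -/
theorem normalClosure_triple_eq {G : Type*} [Group G] (x y z g : G) :
    normalClosure ({x, y⁻¹, g * z * g⁻¹} : Set G) = normalClosure {x, y, z} := by
  apply le_antisymm
  · refine normalClosure_le_normal ?_
    rintro w (rfl | rfl | rfl)
    · exact subset_normalClosure (by simp)
    · exact inv_mem (subset_normalClosure (by simp))
    · exact (normalClosure_normal (s := ({x, y, z} : Set G))).conj_mem _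
        (subset_normalClosure (by simp)) g
  · refine normalClosure_le_normal ?_
    rintro w (rfl | rfl | rfl)
    · exact subset_normalClosure (by simp)
    · rw [← inv_inv w]
      exact inv_mem (subset_normalClosure (by simp))
    · have hmem : g * w * g⁻¹ ∈ normalClosure ({x, y⁻¹, g * w * g⁻¹} : Set G) :=
        subset_normalClosure (by simp)
      have key := (normalClosure_normal (s := ({x, y⁻¹, g * w * g⁻¹} : Set G))).conj_mem _ hmem g⁻¹
      simpa [mul_assoc] using key

/-- `σ N₀ = N₁`. [folklore] -/
theorem map_swap_s4Kernels_zero :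
    (s4Kernels 0).map swapEquiv.toMonoidHom = s4Kernels 1 := by
  have h0 : s4Kernels 0 = normalClosure {SurfaceGroup.a 0, SurfaceGroup.a 1, SurfaceGroup.b 2} := rfl
  have h1 : s4Kernels 1 = normalClosure {SurfaceGroup.a 0, SurfaceGroup.b 1, SurfaceGroup.a 2} := rfl
  rw [h0, h1, map_normalClosure _ swapEquiv.toMonoidHom (by exact swapEquiv.surjective)]
  simp only [Set.image_insert_eq, Set.image_singleton, MulEquiv.coe_toMonoidHom, swapEquiv_a_zero,
    swapEquiv_a_one, swapEquiv_b_two]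
  exact normalClosure_triple_eq _ _ _ _

/-- `σ N₁ = N₀`. [folklore] -/
theorem map_swap_s4Kernels_one :
    (s4Kernels 1).map swapEquiv.toMonoidHom = s4Kernels 0 := by
  have h0 : s4Kernels 0 = normalClosure {SurfaceGroup.a 0, SurfaceGroup.a 1, SurfaceGroup.b 2} := rfl
  have h1 : s4Kernels 1 = normalClosure {SurfaceGroup.a 0, SurfaceGroup.b 1, SurfaceGroup.a 2} := rfl
  rw [h0, h1, map_normalClosure _ swapEquiv.toMonoidHom (by exact swapEquiv.surjective)]
  simp only [Set.image_insert_eq, Set.image_singleton, MulEquiv.coe_toMonoidHom, swapEquiv_a_zero,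
    swapEquiv_b_one, swapEquiv_a_two]
  -- {a₀, b₁ a₁ b₁⁻¹, b₂⁻¹} vs {a₀, a₁, b₂}: reorder to apply the triple lemma
  have : ({SurfaceGroup.a 0, SurfaceGroup.b 1 * SurfaceGroup.a 1 * (SurfaceGroup.b 1)⁻¹,
      (SurfaceGroup.b 2)⁻¹} : Set (SurfaceGroup 3)) =
      {SurfaceGroup.a 0, (SurfaceGroup.b 2)⁻¹, SurfaceGroup.b 1 * SurfaceGroup.a 1 * (SurfaceGroup.b 1)⁻¹} := by
    ext w; simp [or_comm]
  rw [this, normalClosure_triple_eq]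
  congr 1
  ext w; simp [or_comm]

/-- ORDERED = UNORDERED (sanity of the ordered conclusion): the standard genus-3 Heegaard pair
`(N₀, N₁)` of `S¹×S²` admits a side swap in `Aut S_3`. Hence an unordered Waldhausen
equivalence `{K_i, K_j} ~ {N_i, N_j}` can always be corrected to the ordered one the crux asks
for (at `m = 0`; in general by the analogous product of half-twists on the non-shared handles).
[folklore] -/
theorem exists_swap_s4Kernels :
    ∃ σ : SurfaceGroup 3 ≃* SurfaceGroup 3,
      (s4Kernels 0).map σ.toMonoidHom = s4Kernels 1 ∧ (s4Kernels 1).map σ.toMonoidHom = s4Kernels 0 :=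
  ⟨swapEquiv, map_swap_s4Kernels_zero, map_swap_s4Kernels_one⟩

/-- Consequence for the prover: at `m = 0` the conclusion of the crux for the pair `(0,1)` is
equivalent to its CROSSED form (compose with `σ`), so an UNORDERED Waldhausen equivalence of the
Heegaard pair suffices at genus 3. [folklore] -/
theorem crossed_of_pair_zero_one {K : TrisectionKernels 3}
    (h : ∃ α : SurfaceGroup 3 ≃* SurfaceGroup 3,
      (s4Kernels 0).map α.toMonoidHom = K 0 ∧ (s4Kernels 1).map α.toMonoidHom = K 1) :
    ∃ β : SurfaceGroup 3 ≃* SurfaceGroup 3,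
      (s4Kernels 0).map β.toMonoidHom = K 1 ∧ (s4Kernels 1).map β.toMonoidHom = K 0 := by
  obtain ⟨α, h0, h1⟩ := h
  have ht : (swapEquiv.trans α).toMonoidHom = α.toMonoidHom.comp swapEquiv.toMonoidHom :=
    MonoidHom.ext fun _ => rfl
  refine ⟨swapEquiv.trans α, ?_, ?_⟩
  · rw [ht, ← Subgroup.map_map, map_swap_s4Kernels_zero, h1]
  · rw [ht, ← Subgroup.map_map, map_swap_s4Kernels_one, h0]

/-! ## §B''' Pairs do not determine the third kernel: the Heegaard group of `(N₀,N₁)` moves `N₂` -/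

/-- Generator images of the Dehn twist `T_h : b_h ↦ b_h a_h` about `a_h` (handle `h`), on the
free group. [folklore] -/
def dehnGen (h : Fin 3) (x : surfaceGen 3) : FreeGroup (surfaceGen 3) :=
  if x = (h, true) then FreeGroup.of (h, true) * FreeGroup.of (h, false) else FreeGroup.of x

/-- Generator images of `T_h⁻¹ : b_h ↦ b_h a_h⁻¹`. [folklore] -/
def undehnGen (h : Fin 3) (x : surfaceGen 3) : FreeGroup (surfaceGen 3) :=
  if x = (h, true) then FreeGroup.of (h, true) * (FreeGroup.of (h, false))⁻¹ else FreeGroup.of x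

/-- `T_h` fixes each commutator `[aᵢ, bᵢ]` in the free group. [folklore] -/
theorem lift_dehnGen_comm (h i : Fin 3) :
    FreeGroup.lift (dehnGen h) (genA i * genB i * (genA i)⁻¹ * (genB i)⁻¹) =
      genA i * genB i * (genA i)⁻¹ * (genB i)⁻¹ := by
  simp only [dehnGen, genA, genB, map_mul, map_inv, FreeGroup.lift_apply_of]
  by_cases hi : i = h
  · subst hi
    simp
    group
  · have h1 : ((i, false) : surfaceGen 3) ≠ (h, true) := by simp
    have h2 : ((i, true) : surfaceGen 3) ≠ (h, true) := by simpa using hi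
    simp [h1, h2]

/-- `T_h⁻¹` fixes each commutator `[aᵢ, bᵢ]` in the free group. [folklore] -/
theorem lift_undehnGen_comm (h i : Fin 3) :
    FreeGroup.lift (undehnGen h) (genA i * genB i * (genA i)⁻¹ * (genB i)⁻¹) =
      genA i * genB i * (genA i)⁻¹ * (genB i)⁻¹ := by
  simp only [undehnGen, genA, genB, map_mul, map_inv, FreeGroup.lift_apply_of]
  by_cases hi : i = h
  · subst hi
    simp
    group
  · have h1 : ((i, false) : surfaceGen 3) ≠ (h, true) := by simp
    have h2 : ((i, true) : surfaceGen 3) ≠ (h, true) := by simpa using hi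
    simp [h1, h2]

/-- `T_h` fixes the surface relator. [folklore] -/
theorem lift_dehnGen_surfaceRelator (h : Fin 3) :
    FreeGroup.lift (dehnGen h) (surfaceRelator 3) = surfaceRelator 3 := by
  unfold surfaceRelator
  rw [map_list_prod, List.map_map]
  exact congrArg List.prod (List.map_congr_left fun i _ => lift_dehnGen_comm h i)

/-- `T_h⁻¹` fixes the surface relator. [folklore] -/
theorem lift_undehnGen_surfaceRelator (h : Fin 3) :
    FreeGroup.lift (undehnGen h) (surfaceRelator 3) = surfaceRelator 3 := by
  unfold surfaceRelator
  rw [map_list_prod, List.map_map]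
  exact congrArg List.prod (List.map_congr_left fun i _ => lift_undehnGen_comm h i)

/-- `T_h` as an endomorphism of `S_3`. [folklore] -/
def dehnHom (h : Fin 3) : SurfaceGroup 3 →* SurfaceGroup 3 :=
  presentedLift ((PresentedGroup.mk _).comp (FreeGroup.lift (dehnGen h))) (by
    intro r hr
    rw [Set.mem_singleton_iff] at hr
    subst hr
    rw [MonoidHom.comp_apply, lift_dehnGen_surfaceRelator]
    exact PresentedGroup.one_of_mem (Set.mem_singleton _))

/-- `T_h⁻¹` as an endomorphism of `S_3`. [folklore] -/
def undehnHom (h : Fin 3) : SurfaceGroup 3 →* SurfaceGroup 3 :=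
  presentedLift ((PresentedGroup.mk _).comp (FreeGroup.lift (undehnGen h))) (by
    intro r hr
    rw [Set.mem_singleton_iff] at hr
    subst hr
    rw [MonoidHom.comp_apply, lift_undehnGen_surfaceRelator]
    exact PresentedGroup.one_of_mem (Set.mem_singleton _))

/-- `T_h` on the class of a word. [folklore] -/
@[simp] theorem dehnHom_mk (h : Fin 3) (w : FreeGroup (surfaceGen 3)) :
    dehnHom h (PresentedGroup.mk _ w) = PresentedGroup.mk _ (FreeGroup.lift (dehnGen h) w) := by
  simp [dehnHom]

/-- `T_h⁻¹` on the class of a word. [folklore] -/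
@[simp] theorem undehnHom_mk (h : Fin 3) (w : FreeGroup (surfaceGen 3)) :
    undehnHom h (PresentedGroup.mk _ w) = PresentedGroup.mk _ (FreeGroup.lift (undehnGen h) w) := by
  simp [undehnHom]

/-- The Dehn twist `T_h : b_h ↦ b_h a_h` as an automorphism of `S_3`. [folklore] -/
def dehnEquiv (h : Fin 3) : SurfaceGroup 3 ≃* SurfaceGroup 3 :=
  MonoidHom.toMulEquiv (dehnHom h) (undehnHom h)
    (PresentedGroup.ext fun x => by
      obtain ⟨k, b⟩ := x
      fin_cases h <;> fin_cases k <;> cases b <;> simp [dehnGen, undehnGen, PresentedGroup.of])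
    (PresentedGroup.ext fun x => by
      obtain ⟨k, b⟩ := x
      fin_cases h <;> fin_cases k <;> cases b <;> simp [dehnGen, undehnGen, PresentedGroup.of])

/-- `T_h` fixes every `aᵢ`. [folklore] -/
theorem dehnEquiv_a (h i : Fin 3) : dehnEquiv h (SurfaceGroup.a i) = SurfaceGroup.a i := by
  fin_cases h <;> fin_cases i <;> simp [dehnEquiv, SurfaceGroup.a, dehnGen, PresentedGroup.of]

/-- `T_h` fixes `bᵢ` for `i ≠ h`. [folklore] -/
theorem dehnEquiv_b_of_ne {h i : Fin 3} (hi : i ≠ h) :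
    dehnEquiv h (SurfaceGroup.b i) = SurfaceGroup.b i := by
  fin_cases h <;> fin_cases i <;> first | exact absurd rfl hi |
    simp [dehnEquiv, SurfaceGroup.b, dehnGen, PresentedGroup.of]

/-- `T_h b_h = b_h a_h`. [folklore] -/
theorem dehnEquiv_b_self (h : Fin 3) :
    dehnEquiv h (SurfaceGroup.b h) = SurfaceGroup.b h * SurfaceGroup.a h := by
  fin_cases h <;> simp [dehnEquiv, SurfaceGroup.b, SurfaceGroup.a, dehnGen, PresentedGroup.of]

/-- `T₀` (twist about the SHARED curve `a₁` of the pair `(N₀, N₁)`) stabilises `N₀ = ⟪a₁,a₂,b₃⟫`.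
[folklore] -/
theorem map_dehnZero_s4Kernels_zero :
    (s4Kernels 0).map (dehnEquiv 0).toMonoidHom = s4Kernels 0 := by
  have h0 : s4Kernels 0 = normalClosure {SurfaceGroup.a 0, SurfaceGroup.a 1, SurfaceGroup.b 2} := rfl
  rw [h0, map_normalClosure _ (dehnEquiv 0).toMonoidHom (by exact (dehnEquiv 0).surjective)]
  congr 1
  simp [Set.image_insert_eq, Set.image_singleton, dehnEquiv_a,
    dehnEquiv_b_of_ne (show (2 : Fin 3) ≠ 0 by decide)]

/-- `T₀` stabilises `N₁ = ⟪a₁,b₂,a₃⟫`. [folklore] -/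
theorem map_dehnZero_s4Kernels_one :
    (s4Kernels 1).map (dehnEquiv 0).toMonoidHom = s4Kernels 1 := by
  have h1 : s4Kernels 1 = normalClosure {SurfaceGroup.a 0, SurfaceGroup.b 1, SurfaceGroup.a 2} := rfl
  rw [h1, map_normalClosure _ (dehnEquiv 0).toMonoidHom (by exact (dehnEquiv 0).surjective)]
  congr 1
  simp [Set.image_insert_eq, Set.image_singleton, dehnEquiv_a,
    dehnEquiv_b_of_ne (show (1 : Fin 3) ≠ 0 by decide)]

/-- … but `T₀` moves `N₂ = ⟪b₁,a₂,a₃⟫`: `T₀ b₁ = b₁a₁ ∈ T₀ N₂`, `b₁a₁ ∉ N₂` (erase `{b₁,a₂,a₃}`: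
`b₁a₁ ↦ a₁ ≠ 1`). [folklore] -/
theorem map_dehnZero_s4Kernels_two_ne :
    (s4Kernels 2).map (dehnEquiv 0).toMonoidHom ≠ s4Kernels 2 := by
  intro h
  have hmem : SurfaceGroup.b 0 * SurfaceGroup.a 0 ∈ s4Kernels 2 := by
    rw [← h, ← dehnEquiv_b_self]
    exact Subgroup.mem_map_of_mem _ (of_mem_s4Kernels 2 (x := ((0 : Fin 3), true)) (by decide))
  have hker := s4Kernels_le_ker (s4Gens 2) (s4Gens_hits 2) 2 le_rfl hmem
  rw [MonoidHom.mem_ker, map_mul] at hker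
  change eraseHom _ _ (PresentedGroup.of _) * eraseHom _ _ (PresentedGroup.of _) = 1 at hker
  rw [eraseHom_of, eraseHom_of, eraseGen_of_mem (by decide),
    eraseGen_of_not_mem (by decide), one_mul] at hker
  exact FreeGroup.of_ne_one _ hker

/-- REFUTED STRENGTHENING `PairsDetermineThird`: "an automorphism standardising the pair
`(K₀, K₁)` also standardises `K₂`" is FALSE already for `S⁴` (`m = 0`, `K = N`, `α = T₀` the
Dehn twist about the shared curve `a₁`: it lies in the Heegaard group `Stab N₀ ∩ Stab N₁` of the
standard genus-3 splitting of `S¹×S²` but `T₀ N₂ ≠ N₂`). This is the exact gap between the crux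
(pairs, 3-dimensional, a theorem) and simultaneous standardness `Iso N K` (the route's target
modulo stabilisation = SPC4): the three pairwise `α_{ij}` supplied by WaldhausenPairs differ by
elements of Heegaard groups which do not fix the third kernel. [folklore] -/
theorem not_pairsDetermineThird :
    ¬ ∀ (m : ℕ) (K : TrisectionKernels (3 + 3 * m)),
      IsGroupTrisection (3 + 3 * m) (m + 1) (PUnit : Type) K →
      ∀ α : SurfaceGroup (3 + 3 * m) ≃* SurfaceGroup (3 + 3 * m),
        (s4Kernels.stabilizeIter m 0).map α.toMonoidHom = K 0 →
        (s4Kernels.stabilizeIter m 1).map α.toMonoidHom = K 1 →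
        (s4Kernels.stabilizeIter m 2).map α.toMonoidHom = K 2 := fun h =>
  map_dehnZero_s4Kernels_two_ne
    (h 0 s4Kernels s4Kernels_isGroupTrisection_holds (dehnEquiv 0)
      map_dehnZero_s4Kernels_zero map_dehnZero_s4Kernels_one)

/-! ## §C What the statement really quantifies over (information for the prover) -/

/-- ORDERED HEEGAARD PAIRS of type `(g,k)` form one `Aut(S_g)`-orbit: pairs `(A,B)` of normal
subgroups with `S/A ≅ S/B ≅ F_g` and `S/⟪A ∪ B⟫ ≅ F_k`. For `(g,k) = (3+3m, m+1)` (indeed for all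
`g ≥ k`) this is Leininger–Reid + Kneser–Stallings–Perelman + Waldhausen + Dehn–Nielsen; it is
the exact content of the crux (the third kernel and the triple quotient never enter).
[cite: Waldhausen1968; LeiningerReid2002, Lemma 2.2; AbramsGayKirby2018, p.4] -/
def HeegaardPairOrbit (g k : ℕ) : Prop :=
  ∀ A B A' B' : Subgroup (SurfaceGroup g), A.Normal → B.Normal → A'.Normal → B'.Normal →
    IsFreeOfRank (SurfaceGroup g ⧸ normalClosure (A : Set (SurfaceGroup g))) g →
    IsFreeOfRank (SurfaceGroup g ⧸ normalClosure (B : Set (SurfaceGroup g))) g →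
    IsFreeOfRank (SurfaceGroup g ⧸ normalClosure (A' : Set (SurfaceGroup g))) g →
    IsFreeOfRank (SurfaceGroup g ⧸ normalClosure (B' : Set (SurfaceGroup g))) g →
    IsFreeOfRank (SurfaceGroup g ⧸ normalClosure ((A : Set (SurfaceGroup g)) ∪ B)) k →
    IsFreeOfRank (SurfaceGroup g ⧸ normalClosure ((A' : Set (SurfaceGroup g)) ∪ B')) k →
    ∃ α : SurfaceGroup g ≃* SurfaceGroup g, A.map α.toMonoidHom = A' ∧ B.map α.toMonoidHom = B'

/-- REDUCTION (positive, prover's to land — recorded here only to certify that `triple` and the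
third `free_quotient` are not load-bearing): the orbit statement at the balanced types implies
the crux. [folklore] -/
theorem waldhausenPairs_of_heegaardPairOrbit (h : ∀ m, HeegaardPairOrbit (3 + 3 * m) (m + 1)) :
    WaldhausenPairs := by
  intro m K hK i j hij
  have hN := stabilizeIter_isGroupTrisection m
  exact h m (s4Kernels.stabilizeIter m i) (s4Kernels.stabilizeIter m j) (K i) (K j)
    (hN.normal i) (hN.normal j) (hK.normal i) (hK.normal j)
    (hN.free_quotient i) (hN.free_quotient j) (hK.free_quotient i) (hK.free_quotient j)
    (hN.free_pairQuotient i j hij) (hK.free_pairQuotient i j hij)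

/-! ### §C' The two printed facts behind `HeegaardPairOrbit` (decomposition for planners) -/

/-- FACT SHAPE 1 (Leininger–Reid 2002 Lemma 2.2 / Jaco 1969 + Dehn–Nielsen–Baer): handlebody
kernels of genus `g` form ONE `Aut(S_g)`-orbit — any two normal subgroups with quotient free of
rank `g` are carried onto each other by an automorphism. [cite: LeiningerReid2002, Lemma 2.2] -/
def SingleKernelOrbit (g : ℕ) : Prop :=
  ∀ A A' : Subgroup (SurfaceGroup g), A.Normal → A'.Normal →
    IsFreeOfRank (SurfaceGroup g ⧸ normalClosure (A : Set (SurfaceGroup g))) g →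
    IsFreeOfRank (SurfaceGroup g ⧸ normalClosure (A' : Set (SurfaceGroup g))) g →
    ∃ α : SurfaceGroup g ≃* SurfaceGroup g, A.map α.toMonoidHom = A'

/-- FACT SHAPE 2 (Waldhausen 1968 for `#ᵏ S¹×S²` + Kneser–Stallings–Perelman + DNB, relative
form): the stabiliser of a handlebody kernel `A` (the handlebody group) acts transitively on the
complementary handlebody kernels `B` with `S/⟪A ∪ B⟫ ≅ F_k`. [cite: Waldhausen1968] -/
def HeegaardGroupTransitive (g k : ℕ) : Prop :=
  ∀ A B B' : Subgroup (SurfaceGroup g), A.Normal → B.Normal → B'.Normal →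
    IsFreeOfRank (SurfaceGroup g ⧸ normalClosure (A : Set (SurfaceGroup g))) g →
    IsFreeOfRank (SurfaceGroup g ⧸ normalClosure (B : Set (SurfaceGroup g))) g →
    IsFreeOfRank (SurfaceGroup g ⧸ normalClosure (B' : Set (SurfaceGroup g))) g →
    IsFreeOfRank (SurfaceGroup g ⧸ normalClosure ((A : Set (SurfaceGroup g)) ∪ B)) k →
    IsFreeOfRank (SurfaceGroup g ⧸ normalClosure ((A : Set (SurfaceGroup g)) ∪ B')) k →
    ∃ β : SurfaceGroup g ≃* SurfaceGroup g, A.map β.toMonoidHom = A ∧ B.map β.toMonoidHom = B'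

/-- Transport of the single-quotient rank along an automorphism. [folklore] -/
theorem isFreeOfRank_quot_map {g' n : ℕ} (α : SurfaceGroup g' ≃* SurfaceGroup g')
    (B : Subgroup (SurfaceGroup g'))
    (hB : IsFreeOfRank (SurfaceGroup g' ⧸ normalClosure (B : Set (SurfaceGroup g'))) n) :
    IsFreeOfRank (SurfaceGroup g' ⧸ normalClosure ((B.map α.toMonoidHom : Subgroup (SurfaceGroup g')) :
      Set (SurfaceGroup g'))) n := by
  refine hB.of_mulEquiv (QuotientGroup.congr _ _ α ?_)
  rw [map_normalClosure_coe]
  simp [Subgroup.coe_map]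

/-- Transport of the pair-quotient rank along an automorphism. [folklore] -/
theorem isFreeOfRank_pairQuot_map {g' n : ℕ} (α : SurfaceGroup g' ≃* SurfaceGroup g')
    (A B : Subgroup (SurfaceGroup g'))
    (hAB : IsFreeOfRank (SurfaceGroup g' ⧸ normalClosure ((A : Set (SurfaceGroup g')) ∪ B)) n) :
    IsFreeOfRank (SurfaceGroup g' ⧸ normalClosure
      (((A.map α.toMonoidHom : Subgroup (SurfaceGroup g')) : Set (SurfaceGroup g')) ∪
        (B.map α.toMonoidHom : Subgroup (SurfaceGroup g')))) n := by
  refine hAB.of_mulEquiv (QuotientGroup.congr _ _ α ?_)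
  rw [map_normalClosure_coe]
  simp [Subgroup.coe_map, Set.image_union]

/-- DECOMPOSITION: the two fact shapes give the orbit statement (pure algebra: move `A` to `A'`
by shape 1, then correct `B` inside the stabiliser of `A'` by shape 2). So the crux follows from
`SingleKernelOrbit (3+3m)` and `HeegaardGroupTransitive (3+3m) (m+1)` for all `m`
(with `waldhausenPairs_of_heegaardPairOrbit`). [folklore] -/
theorem heegaardPairOrbit_of_facts {g' k : ℕ} (h1 : SingleKernelOrbit g')
    (h2 : HeegaardGroupTransitive g' k) : HeegaardPairOrbit g' k := by
  intro A B A' B' hA hB hA' hB' fA fB fA' fB' fAB fA'B'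
  obtain ⟨α, hα⟩ := h1 A A' hA hA' fA fA'
  have hαB : (B.map α.toMonoidHom).Normal := Subgroup.Normal.map hB _ α.surjective
  have fαB := isFreeOfRank_quot_map α B fB
  have fαAB := isFreeOfRank_pairQuot_map α A B fAB
  rw [hα] at fαAB
  obtain ⟨β, hβA, hβB⟩ := h2 A' (B.map α.toMonoidHom) B' hA' hαB hB' fA' fαB fB' fαAB fA'B'
  have ht : (α.trans β).toMonoidHom = β.toMonoidHom.comp α.toMonoidHom := MonoidHom.ext fun _ => rfl
  refine ⟨α.trans β, ?_, ?_⟩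
  · rw [ht, ← Subgroup.map_map, hα, hβA]
  · rw [ht, ← Subgroup.map_map, hβB]

/-- Hence: the crux from the two printed fact shapes at the balanced types. [folklore] -/
theorem waldhausenPairs_of_facts (h1 : ∀ m, SingleKernelOrbit (3 + 3 * m))
    (h2 : ∀ m, HeegaardGroupTransitive (3 + 3 * m) (m + 1)) : WaldhausenPairs :=
  waldhausenPairs_of_heegaardPairOrbit fun m => heegaardPairOrbit_of_facts (h1 m) (h2 m)



/-! ## §S Slot symmetry of the standard triple at EVERY genus (cycle 2)

The standard `(3+3m; m+1)` triple `N = s4Kernels.stabilizeIter m` is symmetric under all six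
permutations of its slots: `stabilizeIter_slotSymmetric m π : ∃ σ ∈ Aut S_{3+3m}, ∀ i, σ N_i = N_{π i}`.
Mechanism: relator-fixing automorphisms of the free group (`RelatorAut`, fixing `∏[aᵢ,bᵢ]` ON THE
NOSE) admit BLOCK SUMS along `S_{g+3} = S_g ∗_ℤ S_3` and act slot by slot on stabilisations
(`map_blockSum_stabilize`); at genus 3 the corrected cyclic handle shift `cyc` and the corrected
adjacent handle transposition `swp` (triage-2's `Swap.lean` pattern) fix the relator on the nose and
realise a 3-cycle and a transposition of the slots; induction on `m`.  Consequences recorded here: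
`exists_swap_stabilizeIter` (ORDERED = UNORDERED at every genus — closes the caveat of §B''),
`exists_aut_pair_stabilizeIter` (all six ordered standard pairs are `Aut`-equivalent),
`isGroupTrisection_comp_perm` (the hypothesis is slot-symmetric) and `waldhausenPairs_iff_slice`
(THE CRUX IS ITS `(0,1)`-SLICE: it suffices to standardise the first pair of every trisection of
the trivial group).  Proposed to Literature as `StandardTrisectionSlotSymmetry.lean` (p76319; same content
minus `waldhausenPairs_iff_slice`, namespace `Literature.Topology.FourManifolds`), so that
ShadowsStandard / NilpotentShadows provers can argue "WLOG slot 0" and import `RelatorAut`. -/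

namespace SlotSymmetry

variable {g h : ℕ}

/-- Free-level data of an automorphism of `S_g` compatible with connected sums: an automorphism
of `F⟨a₁,…,b_g⟩` (with its inverse) fixing the surface relator ON THE NOSE. [folklore] -/
structure RelatorAut (g : ℕ) where
  /-- the free-group endomorphism -/
  hom : FreeGroup (surfaceGen g) →* FreeGroup (surfaceGen g)
  /-- its inverse -/
  inv : FreeGroup (surfaceGen g) →* FreeGroup (surfaceGen g)
  hom_rel : hom (surfaceRelator g) = surfaceRelator g
  inv_rel : inv (surfaceRelator g) = surfaceRelator g
  inv_comp : inv.comp hom = MonoidHom.id _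
  hom_comp : hom.comp inv = MonoidHom.id _

namespace RelatorAut

/-- A relator-fixing endomorphism kills the relator in `S_g`. [folklore] -/
theorem mk_comp_rel (φ : FreeGroup (surfaceGen g) →* FreeGroup (surfaceGen g))
    (hφ : φ (surfaceRelator g) = surfaceRelator g) :
    ∀ r ∈ ({surfaceRelator g} : Set (FreeGroup (surfaceGen g))),
      ((PresentedGroup.mk ({surfaceRelator g} : Set (FreeGroup (surfaceGen g)))).comp φ) r = 1 := by
  intro r hr
  rw [Set.mem_singleton_iff] at hr
  subst hr
  rw [MonoidHom.comp_apply, hφ]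
  exact PresentedGroup.one_of_mem (Set.mem_singleton _)

/-- The induced endomorphism of `S_g`. [folklore] -/
def toHom (A : RelatorAut g) : SurfaceGroup g →* SurfaceGroup g :=
  presentedLift ((PresentedGroup.mk _).comp A.hom) (mk_comp_rel A.hom A.hom_rel)

/-- The induced inverse endomorphism of `S_g`. [folklore] -/
def invHom (A : RelatorAut g) : SurfaceGroup g →* SurfaceGroup g :=
  presentedLift ((PresentedGroup.mk _).comp A.inv) (mk_comp_rel A.inv A.inv_rel)

@[simp] theorem toHom_mk (A : RelatorAut g) (w : FreeGroup (surfaceGen g)) :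
    A.toHom (PresentedGroup.mk _ w) = PresentedGroup.mk _ (A.hom w) := by
  simp [toHom]

@[simp] theorem invHom_mk (A : RelatorAut g) (w : FreeGroup (surfaceGen g)) :
    A.invHom (PresentedGroup.mk _ w) = PresentedGroup.mk _ (A.inv w) := by
  simp [invHom]

theorem invHom_comp_toHom (A : RelatorAut g) : A.invHom.comp A.toHom = MonoidHom.id _ :=
  MonoidHom.ext fun x => by
    obtain ⟨w, rfl⟩ := PresentedGroup.mk_surjective _ x
    rw [MonoidHom.comp_apply, toHom_mk, invHom_mk, ← MonoidHom.comp_apply A.inv, A.inv_comp]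
    rfl

theorem toHom_comp_invHom (A : RelatorAut g) : A.toHom.comp A.invHom = MonoidHom.id _ :=
  MonoidHom.ext fun x => by
    obtain ⟨w, rfl⟩ := PresentedGroup.mk_surjective _ x
    rw [MonoidHom.comp_apply, invHom_mk, toHom_mk, ← MonoidHom.comp_apply A.hom, A.hom_comp]
    rfl

/-- The induced automorphism of `S_g`. [folklore] -/
def toMulEquiv (A : RelatorAut g) : SurfaceGroup g ≃* SurfaceGroup g :=
  MonoidHom.toMulEquiv A.toHom A.invHom A.invHom_comp_toHom A.toHom_comp_invHom

@[simp] theorem toMulEquiv_mk (A : RelatorAut g) (w : FreeGroup (surfaceGen g)) :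
    A.toMulEquiv (PresentedGroup.mk _ w) = PresentedGroup.mk _ (A.hom w) :=
  A.toHom_mk w

@[simp] theorem toMulEquiv_symm_mk (A : RelatorAut g) (w : FreeGroup (surfaceGen g)) :
    A.toMulEquiv.symm (PresentedGroup.mk _ w) = PresentedGroup.mk _ (A.inv w) :=
  A.invHom_mk w

/-- Identity. [folklore] -/
def refl : RelatorAut g := ⟨MonoidHom.id _, MonoidHom.id _, rfl, rfl, rfl, rfl⟩

/-- Composition (`A` first, then `B`). [folklore] -/
def trans (A B : RelatorAut g) : RelatorAut g where
  hom := B.hom.comp A.hom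
  inv := A.inv.comp B.inv
  hom_rel := by rw [MonoidHom.comp_apply, A.hom_rel, B.hom_rel]
  inv_rel := by rw [MonoidHom.comp_apply, B.inv_rel, A.inv_rel]
  inv_comp := MonoidHom.ext fun x => by
    have h1 := DFunLike.congr_fun B.inv_comp (A.hom x)
    have h2 := DFunLike.congr_fun A.inv_comp x
    simp only [MonoidHom.comp_apply, MonoidHom.id_apply] at h1 h2 ⊢
    rw [h1, h2]
  hom_comp := MonoidHom.ext fun x => by
    have h1 := DFunLike.congr_fun A.hom_comp (B.inv x)
    have h2 := DFunLike.congr_fun B.hom_comp x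
    simp only [MonoidHom.comp_apply, MonoidHom.id_apply] at h1 h2 ⊢
    rw [h1, h2]

theorem map_toMulEquiv_refl (K : Subgroup (SurfaceGroup g)) :
    K.map (refl : RelatorAut g).toMulEquiv.toMonoidHom = K := by
  have : (refl : RelatorAut g).toMulEquiv.toMonoidHom = MonoidHom.id _ :=
    MonoidHom.ext fun x => by
      obtain ⟨w, rfl⟩ := PresentedGroup.mk_surjective _ x
      rw [MulEquiv.coe_toMonoidHom, toMulEquiv_mk]; rfl
  rw [this, Subgroup.map_id]

theorem map_toMulEquiv_trans (A B : RelatorAut g) (K : Subgroup (SurfaceGroup g)) :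
    K.map (A.trans B).toMulEquiv.toMonoidHom =
      (K.map A.toMulEquiv.toMonoidHom).map B.toMulEquiv.toMonoidHom := by
  have : (A.trans B).toMulEquiv.toMonoidHom =
      B.toMulEquiv.toMonoidHom.comp A.toMulEquiv.toMonoidHom :=
    MonoidHom.ext fun x => by
      obtain ⟨w, rfl⟩ := PresentedGroup.mk_surjective _ x
      simp only [MulEquiv.coe_toMonoidHom, MonoidHom.comp_apply, toMulEquiv_mk]
      rfl
  rw [this, Subgroup.map_map]

/-- Block sum of relator-fixing automorphisms of genera `g` and `h`: a relator-fixing automorphism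
of genus `g + h` (`r_{g+h} = ι r_g · σ r_h`). [folklore] -/
def blockSum (A : RelatorAut g) (B : RelatorAut h) : RelatorAut (g + h) where
  hom := freeExtend ((genInclAdd g h).comp A.hom) ((genShiftAdd g h).comp B.hom)
  inv := freeExtend ((genInclAdd g h).comp A.inv) ((genShiftAdd g h).comp B.inv)
  hom_rel := by
    rw [surfaceRelator_add, map_mul, ← MonoidHom.comp_apply, freeExtend_comp_genInclAdd,
      ← MonoidHom.comp_apply (freeExtend _ _) (genShiftAdd g h), freeExtend_comp_genShiftAdd,
      MonoidHom.comp_apply, MonoidHom.comp_apply, A.hom_rel, B.hom_rel]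
  inv_rel := by
    rw [surfaceRelator_add, map_mul, ← MonoidHom.comp_apply, freeExtend_comp_genInclAdd,
      ← MonoidHom.comp_apply (freeExtend _ _) (genShiftAdd g h), freeExtend_comp_genShiftAdd,
      MonoidHom.comp_apply, MonoidHom.comp_apply, A.inv_rel, B.inv_rel]
  inv_comp := by
    refine freeGroup_hom_ext_add ?_ ?_
    · rw [MonoidHom.comp_assoc, freeExtend_comp_genInclAdd, ← MonoidHom.comp_assoc,
        freeExtend_comp_genInclAdd, MonoidHom.comp_assoc, A.inv_comp, MonoidHom.comp_id,
        MonoidHom.id_comp]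
    · rw [MonoidHom.comp_assoc, freeExtend_comp_genShiftAdd, ← MonoidHom.comp_assoc,
        freeExtend_comp_genShiftAdd, MonoidHom.comp_assoc, B.inv_comp, MonoidHom.comp_id,
        MonoidHom.id_comp]
  hom_comp := by
    refine freeGroup_hom_ext_add ?_ ?_
    · rw [MonoidHom.comp_assoc, freeExtend_comp_genInclAdd, ← MonoidHom.comp_assoc,
        freeExtend_comp_genInclAdd, MonoidHom.comp_assoc, A.hom_comp, MonoidHom.comp_id,
        MonoidHom.id_comp]
    · rw [MonoidHom.comp_assoc, freeExtend_comp_genShiftAdd, ← MonoidHom.comp_assoc,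
        freeExtend_comp_genShiftAdd, MonoidHom.comp_assoc, B.hom_comp, MonoidHom.comp_id,
        MonoidHom.id_comp]

theorem blockSum_hom_genInclAdd (A : RelatorAut g) (B : RelatorAut h) (w : FreeGroup (surfaceGen g)) :
    (A.blockSum B).hom (genInclAdd g h w) = genInclAdd g h (A.hom w) :=
  DFunLike.congr_fun (freeExtend_comp_genInclAdd ((genInclAdd g h).comp A.hom)
    ((genShiftAdd g h).comp B.hom)) w

theorem blockSum_hom_genShiftAdd (A : RelatorAut g) (B : RelatorAut h) (w : FreeGroup (surfaceGen h)) :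
    (A.blockSum B).hom (genShiftAdd g h w) = genShiftAdd g h (B.hom w) :=
  DFunLike.congr_fun (freeExtend_comp_genShiftAdd ((genInclAdd g h).comp A.hom)
    ((genShiftAdd g h).comp B.hom)) w

/-- A relator-fixing automorphism permutes full preimages of subgroups of `S_g`. [folklore] -/
theorem image_hom_preimage_mk (A : RelatorAut g) (K : Subgroup (SurfaceGroup g)) :
    A.hom '' ((PresentedGroup.mk _) ⁻¹' (K : Set (SurfaceGroup g))) =
      (PresentedGroup.mk _) ⁻¹'
        ((K.map A.toMulEquiv.toMonoidHom : Subgroup (SurfaceGroup g)) : Set (SurfaceGroup g)) := by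
  ext v
  simp only [Set.mem_image, Set.mem_preimage, SetLike.mem_coe, Subgroup.mem_map,
    MulEquiv.coe_toMonoidHom]
  constructor
  · rintro ⟨w, hw, rfl⟩
    exact ⟨PresentedGroup.mk _ w, hw, A.toMulEquiv_mk w⟩
  · rintro ⟨x, hx, hxv⟩
    refine ⟨A.inv v, ?_, DFunLike.congr_fun A.hom_comp v⟩
    have : PresentedGroup.mk _ (A.inv v) = x := by
      rw [← toMulEquiv_symm_mk, ← hxv, MulEquiv.symm_apply_apply]
    rw [this]
    exact hx

theorem blockSum_hom_genIncl (A : RelatorAut g) (B : RelatorAut 3) (w : FreeGroup (surfaceGen g)) :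
    (A.blockSum B).hom (genIncl g w) = genIncl g (A.hom w) :=
  blockSum_hom_genInclAdd A B w

theorem blockSum_hom_genShift (A : RelatorAut g) (B : RelatorAut 3) (w : FreeGroup (surfaceGen 3)) :
    (A.blockSum B).hom (genShift g w) = genShift g (B.hom w) :=
  blockSum_hom_genShiftAdd A B w

/-- ACTION ON STABILISATIONS: the block sum acts slot by slot on `K.stabilize`. [folklore] -/
theorem map_blockSum_stabilize (A : RelatorAut g) (B : RelatorAut 3) (K : TrisectionKernels g)
    (i : Fin 3) :
    (K.stabilize i).map (A.blockSum B).toMulEquiv.toMonoidHom =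
      normalClosure (stabSet
        (((K i).map A.toMulEquiv.toMonoidHom : Subgroup (SurfaceGroup g)) : Set (SurfaceGroup g))
        (((s4Kernels i).map B.toMulEquiv.toMonoidHom : Subgroup (SurfaceGroup 3)) :
          Set (SurfaceGroup 3))) := by
  rw [TrisectionKernels.stabilize_apply,
    Subgroup.map_normalClosure _ _ (by exact (A.blockSum B).toMulEquiv.surjective)]
  congr 1
  simp only [stabSet, Set.image_union, Set.image_image, ← image_hom_preimage_mk]
  congr 1
  · refine Set.image_congr' fun w => ?_
    simp only [Function.comp_apply, MulEquiv.coe_toMonoidHom, toMulEquiv_mk]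
    rw [blockSum_hom_genIncl]
  · refine Set.image_congr' fun w => ?_
    simp only [Function.comp_apply, MulEquiv.coe_toMonoidHom, toMulEquiv_mk]
    rw [blockSum_hom_genShift]

/-- Corollary: if `A` realises the slot permutation `π` on `K` and `B` realises it on the genus-3
standard triple, then `A ⊞ B` realises it on `K.stabilize`. [folklore] -/
theorem map_blockSum_stabilize_of_perm (A : RelatorAut g) (B : RelatorAut 3) (K : TrisectionKernels g)
    (π : Equiv.Perm (Fin 3)) (hA : ∀ i, (K i).map A.toMulEquiv.toMonoidHom = K (π i))
    (hB : ∀ i, (s4Kernels i).map B.toMulEquiv.toMonoidHom = s4Kernels (π i)) (i : Fin 3) :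
    (K.stabilize i).map (A.blockSum B).toMulEquiv.toMonoidHom = K.stabilize (π i) := by
  rw [map_blockSum_stabilize, hA, hB, TrisectionKernels.stabilize_apply]

/-! ### Genus 3: two relator-fixing generators of the slot symmetry -/

/-- Constructor from generator images (genus 3), all four identities checked in the free group.
[folklore] -/
def ofGens (f finv : surfaceGen 3 → FreeGroup (surfaceGen 3))
    (h1 : FreeGroup.lift f (surfaceRelator 3) = surfaceRelator 3)
    (h2 : FreeGroup.lift finv (surfaceRelator 3) = surfaceRelator 3)
    (h3 : ∀ x, FreeGroup.lift finv (f x) = FreeGroup.of x)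
    (h4 : ∀ x, FreeGroup.lift f (finv x) = FreeGroup.of x) : RelatorAut 3 where
  hom := FreeGroup.lift f
  inv := FreeGroup.lift finv
  hom_rel := h1
  inv_rel := h2
  inv_comp := FreeGroup.ext_hom _ _ fun x => by simp [h3]
  hom_comp := FreeGroup.ext_hom _ _ fun x => by simp [h4]

/-- `[a₀, b₀]` as a word. [folklore] -/
def comm0 : FreeGroup (surfaceGen 3) := genA 0 * genB 0 * (genA 0)⁻¹ * (genB 0)⁻¹
/-- `[a₁, b₁]` as a word. [folklore] -/
def comm1 : FreeGroup (surfaceGen 3) := genA 1 * genB 1 * (genA 1)⁻¹ * (genB 1)⁻¹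
/-- `[a₂, b₂]` as a word. [folklore] -/
def comm2 : FreeGroup (surfaceGen 3) := genA 2 * genB 2 * (genA 2)⁻¹ * (genB 2)⁻¹

/-- The relator-fixing CYCLIC HANDLE SHIFT `c : x_h ↦ [a₀,b₀] x_{h+1} [a₀,b₀]⁻¹` (the plain shift
sends `r` to `[a₀,b₀]⁻¹ r [a₀,b₀]`; the inner correction fixes `r` on the nose). [folklore] -/
def cycGen (x : surfaceGen 3) : FreeGroup (surfaceGen 3) :=
  comm0 * FreeGroup.of (x.1 + 1, x.2) * comm0⁻¹

/-- Its inverse `x_h ↦ [a₂,b₂]⁻¹ x_{h+2} [a₂,b₂]`. [folklore] -/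
def cycInvGen (x : surfaceGen 3) : FreeGroup (surfaceGen 3) :=
  comm2⁻¹ * FreeGroup.of (x.1 + 2, x.2) * comm2

/-- The cyclic handle shift as a relator-fixing automorphism. [folklore] -/
def cyc : RelatorAut 3 :=
  ofGens cycGen cycInvGen (by decide) (by decide) (by decide) (by decide)

/-- The relator-fixing ADJACENT HANDLE TRANSPOSITION `t` of handles `1, 2`:
`a₁ ↦ [a₁,b₁] a₂ [a₁,b₁]⁻¹`, `b₁ ↦ [a₁,b₁] b₂ [a₁,b₁]⁻¹`, `a₂ ↦ a₁`, `b₂ ↦ b₁`, handle `0`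
fixed (the naive letter swap does NOT fix `r`). [folklore] -/
def swapGen (x : surfaceGen 3) : FreeGroup (surfaceGen 3) :=
  if x.1 = 1 then comm1 * FreeGroup.of (2, x.2) * comm1⁻¹
  else if x.1 = 2 then FreeGroup.of (1, x.2)
  else FreeGroup.of x

/-- Its inverse: `a₁ ↦ a₂`, `b₁ ↦ b₂`, `a₂ ↦ [a₂,b₂]⁻¹ a₁ [a₂,b₂]`, `b₂ ↦ [a₂,b₂]⁻¹ b₁ [a₂,b₂]`.
[folklore] -/
def swapInvGen (x : surfaceGen 3) : FreeGroup (surfaceGen 3) :=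
  if x.1 = 1 then FreeGroup.of (2, x.2)
  else if x.1 = 2 then comm2⁻¹ * FreeGroup.of (1, x.2) * comm2
  else FreeGroup.of x

/-- The adjacent handle transposition as a relator-fixing automorphism. [folklore] -/
def swp : RelatorAut 3 :=
  ofGens swapGen swapInvGen (by decide) (by decide) (by decide) (by decide)

/-- Criterion for the image of a normal closure under an automorphism. [folklore] -/
theorem map_normalClosure_eq_of {G : Type*} [Group G] (σ : G ≃* G) (s t : Set G)
    (h1 : ∀ x ∈ s, σ x ∈ normalClosure t) (h2 : ∀ y ∈ t, σ.symm y ∈ normalClosure s) :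
    (normalClosure s).map σ.toMonoidHom = normalClosure t := by
  apply le_antisymm
  · rw [Subgroup.map_le_iff_le_comap]
    exact normalClosure_le_normal fun x hx => by simpa using h1 x hx
  · rw [Subgroup.map_equiv_eq_comap_symm']
    exact normalClosure_le_normal fun y hy => by simpa using h2 y hy

/-- the three standard kernels, unfolded -/
theorem s4Kernels_zero : s4Kernels 0 =
    normalClosure {SurfaceGroup.a 0, SurfaceGroup.a 1, SurfaceGroup.b 2} := rfl
theorem s4Kernels_one : s4Kernels 1 =
    normalClosure {SurfaceGroup.a 0, SurfaceGroup.b 1, SurfaceGroup.a 2} := rfl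
theorem s4Kernels_two : s4Kernels 2 =
    normalClosure {SurfaceGroup.b 0, SurfaceGroup.a 1, SurfaceGroup.a 2} := rfl

/-- conjugates of members of a normal closure are members -/
theorem conj_mem_nc {G : Type*} [Group G] {s : Set G} (c x : G) (hx : x ∈ normalClosure s) :
    c * x * c⁻¹ ∈ normalClosure s :=
  (normalClosure_normal (s := s)).conj_mem x hx c

theorem conj_mem_nc' {G : Type*} [Group G] {s : Set G} (c x : G) (hx : x ∈ normalClosure s) :
    c⁻¹ * x * c ∈ normalClosure s := by
  simpa using (normalClosure_normal (s := s)).conj_mem x hx c⁻¹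

/-- images of generators under `cyc` / `swp` and their inverses, in `S_3` -/
theorem cyc_of (x : surfaceGen 3) : cyc.toMulEquiv (PresentedGroup.of x) =
    PresentedGroup.mk _ comm0 * PresentedGroup.of (x.1 + 1, x.2) * (PresentedGroup.mk _ comm0)⁻¹ := by
  change cyc.toMulEquiv (PresentedGroup.mk _ (FreeGroup.of x)) = _
  rw [toMulEquiv_mk]
  simp [cyc, ofGens, cycGen, PresentedGroup.of]

theorem cyc_symm_of (x : surfaceGen 3) : cyc.toMulEquiv.symm (PresentedGroup.of x) =
    (PresentedGroup.mk _ comm2)⁻¹ * PresentedGroup.of (x.1 + 2, x.2) * PresentedGroup.mk _ comm2 := by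
  change cyc.toMulEquiv.symm (PresentedGroup.mk _ (FreeGroup.of x)) = _
  rw [toMulEquiv_symm_mk]
  simp [cyc, ofGens, cycInvGen, PresentedGroup.of]

theorem swp_of (x : surfaceGen 3) : swp.toMulEquiv (PresentedGroup.of x) =
    PresentedGroup.mk _ (swapGen x) := by
  change swp.toMulEquiv (PresentedGroup.mk _ (FreeGroup.of x)) = _
  rw [toMulEquiv_mk]
  simp [swp, ofGens]

theorem swp_symm_of (x : surfaceGen 3) : swp.toMulEquiv.symm (PresentedGroup.of x) =
    PresentedGroup.mk _ (swapInvGen x) := by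
  change swp.toMulEquiv.symm (PresentedGroup.mk _ (FreeGroup.of x)) = _
  rw [toMulEquiv_symm_mk]
  simp [swp, ofGens]

/-- The slot permutation of `cyc`: `0 ↦ 2 ↦ 1 ↦ 0`. [folklore] -/
def cycPerm : Equiv.Perm (Fin 3) := Equiv.swap 1 2 * Equiv.swap 0 1

theorem cycPerm_apply : cycPerm 0 = 2 ∧ cycPerm 1 = 0 ∧ cycPerm 2 = 1 := by decide

/-- The slot permutation of `swp`: `0 ↔ 1`. [folklore] -/
def swpPerm : Equiv.Perm (Fin 3) := Equiv.swap 0 1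


/-! ### Fin 3 arithmetic helpers -/
theorem fin3_zero_add_one : (0 : Fin 3) + 1 = 1 := by decide
theorem fin3_two_add_one : (2 : Fin 3) + 1 = 0 := by decide
theorem fin3_one_add_one : (1 : Fin 3) + 1 = 2 := by decide
theorem fin3_one_add_two : (1 : Fin 3) + 2 = 0 := by decide
theorem fin3_two_add_two : (2 : Fin 3) + 2 = 1 := by decide
theorem fin3_zero_add_two : (0 : Fin 3) + 2 = 2 := by decide

/-- `C0 = [a₀,b₀]`, `C1 = [a₁,b₁]`, `C2 = [a₂,b₂]` in `S_3`. -/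
def C0 : SurfaceGroup 3 := PresentedGroup.mk _ comm0
def C1 : SurfaceGroup 3 := PresentedGroup.mk _ comm1
def C2 : SurfaceGroup 3 := PresentedGroup.mk _ comm2

theorem cyc_a (i : Fin 3) : cyc.toMulEquiv (SurfaceGroup.a i) = C0 * SurfaceGroup.a (i + 1) * C0⁻¹ :=
  cyc_of (i, false)
theorem cyc_b (i : Fin 3) : cyc.toMulEquiv (SurfaceGroup.b i) = C0 * SurfaceGroup.b (i + 1) * C0⁻¹ :=
  cyc_of (i, true)
theorem cyc_symm_a (i : Fin 3) :
    cyc.toMulEquiv.symm (SurfaceGroup.a i) = C2⁻¹ * SurfaceGroup.a (i + 2) * C2 :=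
  cyc_symm_of (i, false)
theorem cyc_symm_b (i : Fin 3) :
    cyc.toMulEquiv.symm (SurfaceGroup.b i) = C2⁻¹ * SurfaceGroup.b (i + 2) * C2 :=
  cyc_symm_of (i, true)

theorem swp_a0 : swp.toMulEquiv (SurfaceGroup.a 0) = SurfaceGroup.a 0 := by
  rw [SurfaceGroup.a, swp_of]; simp [swapGen, PresentedGroup.of]
theorem swp_b0 : swp.toMulEquiv (SurfaceGroup.b 0) = SurfaceGroup.b 0 := by
  rw [SurfaceGroup.b, swp_of]; simp [swapGen, PresentedGroup.of]
theorem swp_a1 : swp.toMulEquiv (SurfaceGroup.a 1) = C1 * SurfaceGroup.a 2 * C1⁻¹ := by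
  rw [SurfaceGroup.a, swp_of]; simp [swapGen, PresentedGroup.of, SurfaceGroup.a, C1]
theorem swp_b1 : swp.toMulEquiv (SurfaceGroup.b 1) = C1 * SurfaceGroup.b 2 * C1⁻¹ := by
  rw [SurfaceGroup.b, swp_of]; simp [swapGen, PresentedGroup.of, SurfaceGroup.b, C1]
theorem swp_a2 : swp.toMulEquiv (SurfaceGroup.a 2) = SurfaceGroup.a 1 := by
  rw [SurfaceGroup.a, swp_of]; simp [swapGen, PresentedGroup.of, SurfaceGroup.a]
theorem swp_b2 : swp.toMulEquiv (SurfaceGroup.b 2) = SurfaceGroup.b 1 := by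
  rw [SurfaceGroup.b, swp_of]; simp [swapGen, PresentedGroup.of, SurfaceGroup.b]
theorem swp_symm_a0 : swp.toMulEquiv.symm (SurfaceGroup.a 0) = SurfaceGroup.a 0 := by
  rw [SurfaceGroup.a, swp_symm_of]; simp [swapInvGen, PresentedGroup.of]
theorem swp_symm_b0 : swp.toMulEquiv.symm (SurfaceGroup.b 0) = SurfaceGroup.b 0 := by
  rw [SurfaceGroup.b, swp_symm_of]; simp [swapInvGen, PresentedGroup.of]
theorem swp_symm_a1 : swp.toMulEquiv.symm (SurfaceGroup.a 1) = SurfaceGroup.a 2 := by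
  rw [SurfaceGroup.a, swp_symm_of]; simp [swapInvGen, PresentedGroup.of, SurfaceGroup.a]
theorem swp_symm_b1 : swp.toMulEquiv.symm (SurfaceGroup.b 1) = SurfaceGroup.b 2 := by
  rw [SurfaceGroup.b, swp_symm_of]; simp [swapInvGen, PresentedGroup.of, SurfaceGroup.b]
theorem swp_symm_a2 : swp.toMulEquiv.symm (SurfaceGroup.a 2) = C2⁻¹ * SurfaceGroup.a 1 * C2 := by
  rw [SurfaceGroup.a, swp_symm_of]; simp [swapInvGen, PresentedGroup.of, SurfaceGroup.a, C2]
theorem swp_symm_b2 : swp.toMulEquiv.symm (SurfaceGroup.b 2) = C2⁻¹ * SurfaceGroup.b 1 * C2 := by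
  rw [SurfaceGroup.b, swp_symm_of]; simp [swapInvGen, PresentedGroup.of, SurfaceGroup.b, C2]

/-! ### Slot actions at genus 3 -/

/-- `cyc N₀ = N₂`. [folklore] -/
theorem map_cyc_zero : (s4Kernels 0).map cyc.toMulEquiv.toMonoidHom = s4Kernels 2 := by
  rw [s4Kernels_zero, s4Kernels_two]
  refine map_normalClosure_eq_of _ _ _ ?_ ?_
  · intro x hx
    simp only [Set.mem_insert_iff, Set.mem_singleton_iff] at hx
    rcases hx with rfl | rfl | rfl
    · rw [cyc_a, fin3_zero_add_one]; exact conj_mem_nc _ _ (subset_normalClosure (by simp))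
    · rw [cyc_a, fin3_one_add_one]; exact conj_mem_nc _ _ (subset_normalClosure (by simp))
    · rw [cyc_b, fin3_two_add_one]; exact conj_mem_nc _ _ (subset_normalClosure (by simp))
  · intro y hy
    simp only [Set.mem_insert_iff, Set.mem_singleton_iff] at hy
    rcases hy with rfl | rfl | rfl
    · rw [cyc_symm_b, fin3_zero_add_two]; exact conj_mem_nc' _ _ (subset_normalClosure (by simp))
    · rw [cyc_symm_a, fin3_one_add_two]; exact conj_mem_nc' _ _ (subset_normalClosure (by simp))
    · rw [cyc_symm_a, fin3_two_add_two]; exact conj_mem_nc' _ _ (subset_normalClosure (by simp))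

/-- `cyc N₁ = N₀`. [folklore] -/
theorem map_cyc_one : (s4Kernels 1).map cyc.toMulEquiv.toMonoidHom = s4Kernels 0 := by
  rw [s4Kernels_one, s4Kernels_zero]
  refine map_normalClosure_eq_of _ _ _ ?_ ?_
  · intro x hx
    simp only [Set.mem_insert_iff, Set.mem_singleton_iff] at hx
    rcases hx with rfl | rfl | rfl
    · rw [cyc_a, fin3_zero_add_one]; exact conj_mem_nc _ _ (subset_normalClosure (by simp))
    · rw [cyc_b, fin3_one_add_one]; exact conj_mem_nc _ _ (subset_normalClosure (by simp))
    · rw [cyc_a, fin3_two_add_one]; exact conj_mem_nc _ _ (subset_normalClosure (by simp))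
  · intro y hy
    simp only [Set.mem_insert_iff, Set.mem_singleton_iff] at hy
    rcases hy with rfl | rfl | rfl
    · rw [cyc_symm_a, fin3_zero_add_two]; exact conj_mem_nc' _ _ (subset_normalClosure (by simp))
    · rw [cyc_symm_a, fin3_one_add_two]; exact conj_mem_nc' _ _ (subset_normalClosure (by simp))
    · rw [cyc_symm_b, fin3_two_add_two]; exact conj_mem_nc' _ _ (subset_normalClosure (by simp))

/-- `cyc N₂ = N₁`. [folklore] -/
theorem map_cyc_two : (s4Kernels 2).map cyc.toMulEquiv.toMonoidHom = s4Kernels 1 := by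
  rw [s4Kernels_two, s4Kernels_one]
  refine map_normalClosure_eq_of _ _ _ ?_ ?_
  · intro x hx
    simp only [Set.mem_insert_iff, Set.mem_singleton_iff] at hx
    rcases hx with rfl | rfl | rfl
    · rw [cyc_b, fin3_zero_add_one]; exact conj_mem_nc _ _ (subset_normalClosure (by simp))
    · rw [cyc_a, fin3_one_add_one]; exact conj_mem_nc _ _ (subset_normalClosure (by simp))
    · rw [cyc_a, fin3_two_add_one]; exact conj_mem_nc _ _ (subset_normalClosure (by simp))
  · intro y hy
    simp only [Set.mem_insert_iff, Set.mem_singleton_iff] at hy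
    rcases hy with rfl | rfl | rfl
    · rw [cyc_symm_a, fin3_zero_add_two]; exact conj_mem_nc' _ _ (subset_normalClosure (by simp))
    · rw [cyc_symm_b, fin3_one_add_two]; exact conj_mem_nc' _ _ (subset_normalClosure (by simp))
    · rw [cyc_symm_a, fin3_two_add_two]; exact conj_mem_nc' _ _ (subset_normalClosure (by simp))

/-- `swp N₀ = N₁`. [folklore] -/
theorem map_swp_zero : (s4Kernels 0).map swp.toMulEquiv.toMonoidHom = s4Kernels 1 := by
  rw [s4Kernels_zero, s4Kernels_one]
  refine map_normalClosure_eq_of _ _ _ ?_ ?_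
  · intro x hx
    simp only [Set.mem_insert_iff, Set.mem_singleton_iff] at hx
    rcases hx with rfl | rfl | rfl
    · rw [swp_a0]; exact subset_normalClosure (by simp)
    · rw [swp_a1]; exact conj_mem_nc _ _ (subset_normalClosure (by simp))
    · rw [swp_b2]; exact subset_normalClosure (by simp)
  · intro y hy
    simp only [Set.mem_insert_iff, Set.mem_singleton_iff] at hy
    rcases hy with rfl | rfl | rfl
    · rw [swp_symm_a0]; exact subset_normalClosure (by simp)
    · rw [swp_symm_b1]; exact subset_normalClosure (by simp)
    · rw [swp_symm_a2]; exact conj_mem_nc' _ _ (subset_normalClosure (by simp))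

/-- `swp N₁ = N₀`. [folklore] -/
theorem map_swp_one : (s4Kernels 1).map swp.toMulEquiv.toMonoidHom = s4Kernels 0 := by
  rw [s4Kernels_one, s4Kernels_zero]
  refine map_normalClosure_eq_of _ _ _ ?_ ?_
  · intro x hx
    simp only [Set.mem_insert_iff, Set.mem_singleton_iff] at hx
    rcases hx with rfl | rfl | rfl
    · rw [swp_a0]; exact subset_normalClosure (by simp)
    · rw [swp_b1]; exact conj_mem_nc _ _ (subset_normalClosure (by simp))
    · rw [swp_a2]; exact subset_normalClosure (by simp)
  · intro y hy
    simp only [Set.mem_insert_iff, Set.mem_singleton_iff] at hy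
    rcases hy with rfl | rfl | rfl
    · rw [swp_symm_a0]; exact subset_normalClosure (by simp)
    · rw [swp_symm_a1]; exact subset_normalClosure (by simp)
    · rw [swp_symm_b2]; exact conj_mem_nc' _ _ (subset_normalClosure (by simp))

/-- `swp N₂ = N₂`. [folklore] -/
theorem map_swp_two : (s4Kernels 2).map swp.toMulEquiv.toMonoidHom = s4Kernels 2 := by
  rw [s4Kernels_two]
  refine map_normalClosure_eq_of _ _ _ ?_ ?_
  · intro x hx
    simp only [Set.mem_insert_iff, Set.mem_singleton_iff] at hx
    rcases hx with rfl | rfl | rfl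
    · rw [swp_b0]; exact subset_normalClosure (by simp)
    · rw [swp_a1]; exact conj_mem_nc _ _ (subset_normalClosure (by simp))
    · rw [swp_a2]; exact subset_normalClosure (by simp)
  · intro y hy
    simp only [Set.mem_insert_iff, Set.mem_singleton_iff] at hy
    rcases hy with rfl | rfl | rfl
    · rw [swp_symm_b0]; exact subset_normalClosure (by simp)
    · rw [swp_symm_a1]; exact subset_normalClosure (by simp)
    · rw [swp_symm_a2]; exact conj_mem_nc' _ _ (subset_normalClosure (by simp))

theorem map_cyc_s4Kernels (i : Fin 3) :
    (s4Kernels i).map cyc.toMulEquiv.toMonoidHom = s4Kernels (cycPerm i) := by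
  fin_cases i
  · exact map_cyc_zero.trans (congrArg s4Kernels (by decide))
  · exact map_cyc_one.trans (congrArg s4Kernels (by decide))
  · exact map_cyc_two.trans (congrArg s4Kernels (by decide))

theorem map_swp_s4Kernels (i : Fin 3) :
    (s4Kernels i).map swp.toMulEquiv.toMonoidHom = s4Kernels (swpPerm i) := by
  fin_cases i
  · exact map_swp_zero.trans (congrArg s4Kernels (by decide))
  · exact map_swp_one.trans (congrArg s4Kernels (by decide))
  · exact map_swp_two.trans (congrArg s4Kernels (by decide))

/-- Realisers compose. [folklore] -/
theorem realises_trans {g' : ℕ} {K : TrisectionKernels g'} {A B : RelatorAut g'}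
    {π₁ π₂ : Equiv.Perm (Fin 3)}
    (hA : ∀ i, (K i).map A.toMulEquiv.toMonoidHom = K (π₁ i))
    (hB : ∀ i, (K i).map B.toMulEquiv.toMonoidHom = K (π₂ i)) (i : Fin 3) :
    (K i).map (A.trans B).toMulEquiv.toMonoidHom = K ((π₂ * π₁) i) := by
  rw [map_toMulEquiv_trans, hA, hB, Equiv.Perm.mul_apply]

/-- Every slot permutation of the genus-3 standard triple is realised by a relator-fixing
automorphism (`cyc`, `swp` generate `S₃`). [folklore] -/
theorem exists_relatorAut_three (π : Equiv.Perm (Fin 3)) :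
    ∃ B : RelatorAut 3, ∀ i, (s4Kernels i).map B.toMulEquiv.toMonoidHom = s4Kernels (π i) := by
  have key : ∀ π : Equiv.Perm (Fin 3), π = 1 ∨ π = cycPerm ∨ π = cycPerm * cycPerm ∨ π = swpPerm ∨
      π = swpPerm * cycPerm ∨ π = swpPerm * cycPerm * cycPerm := by
    decide
  rcases key π with rfl | rfl | rfl | rfl | rfl | rfl
  · exact ⟨refl, fun i => by rw [map_toMulEquiv_refl]; rfl⟩
  · exact ⟨cyc, map_cyc_s4Kernels⟩
  · exact ⟨cyc.trans cyc, realises_trans map_cyc_s4Kernels map_cyc_s4Kernels⟩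
  · exact ⟨swp, map_swp_s4Kernels⟩
  · exact ⟨cyc.trans swp, realises_trans map_cyc_s4Kernels map_swp_s4Kernels⟩
  · refine ⟨cyc.trans (cyc.trans swp), fun i => ?_⟩
    rw [realises_trans map_cyc_s4Kernels (realises_trans map_cyc_s4Kernels map_swp_s4Kernels) i,
      mul_assoc]

/-- INDUCTION OVER STABILISATIONS: a genus-3 realiser of `π` propagates to every `stabilizeIter m`
by block sums. [folklore] -/
theorem exists_relatorAut_stabilizeIter {π : Equiv.Perm (Fin 3)} (B : RelatorAut 3)
    (hB : ∀ i, (s4Kernels i).map B.toMulEquiv.toMonoidHom = s4Kernels (π i)) :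
    ∀ m : ℕ, ∃ A : RelatorAut (3 + 3 * m),
      ∀ i, (s4Kernels.stabilizeIter m i).map A.toMulEquiv.toMonoidHom = s4Kernels.stabilizeIter m (π i)
  | 0 => ⟨B, hB⟩
  | m + 1 => by
    obtain ⟨A, hA⟩ := exists_relatorAut_stabilizeIter B hB m
    exact ⟨A.blockSum B, fun i => map_blockSum_stabilize_of_perm A B _ π hA hB i⟩

end RelatorAut

open RelatorAut in
/-- **SLOT SYMMETRY OF THE STANDARD TRISECTION OF `S⁴` AT EVERY GENUS.**  For every `m` and every
permutation `π` of the three slots there is an automorphism `σ` of `S_{3+3m}` with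
`σ(N_i) = N_{π i}` for all `i` (`N = s4Kernels.stabilizeIter m`).  In particular the three
kernels, the three ordered pairs and their reversals are indistinguishable up to `Aut S_g`.
[folklore] -/
theorem stabilizeIter_slotSymmetric (m : ℕ) (π : Equiv.Perm (Fin 3)) :
    ∃ σ : SurfaceGroup (3 + 3 * m) ≃* SurfaceGroup (3 + 3 * m),
      ∀ i, (s4Kernels.stabilizeIter m i).map σ.toMonoidHom = s4Kernels.stabilizeIter m (π i) := by
  obtain ⟨B, hB⟩ := exists_relatorAut_three π
  obtain ⟨A, hA⟩ := exists_relatorAut_stabilizeIter B hB m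
  exact ⟨A.toMulEquiv, hA⟩

/-- ORDERED = UNORDERED at every genus: the standard pair `(N_i, N_j)` admits a side swap in
`Aut S_{3+3m}` (generalises §B'' `exists_swap_s4Kernels`, `m = 0`, `(i,j) = (0,1)`). [folklore] -/
theorem exists_swap_stabilizeIter (m : ℕ) (i j : Fin 3) :
    ∃ σ : SurfaceGroup (3 + 3 * m) ≃* SurfaceGroup (3 + 3 * m),
      (s4Kernels.stabilizeIter m i).map σ.toMonoidHom = s4Kernels.stabilizeIter m j ∧
      (s4Kernels.stabilizeIter m j).map σ.toMonoidHom = s4Kernels.stabilizeIter m i := by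
  obtain ⟨σ, hσ⟩ := stabilizeIter_slotSymmetric m (Equiv.swap i j)
  exact ⟨σ, by rw [hσ, Equiv.swap_apply_left], by rw [hσ, Equiv.swap_apply_right]⟩

/-- All ordered standard pairs are `Aut`-equivalent to `(N₀, N₁)`. [folklore] -/
theorem exists_aut_pair_stabilizeIter (m : ℕ) (i j : Fin 3) (hij : i ≠ j) :
    ∃ σ : SurfaceGroup (3 + 3 * m) ≃* SurfaceGroup (3 + 3 * m),
      (s4Kernels.stabilizeIter m 0).map σ.toMonoidHom = s4Kernels.stabilizeIter m i ∧
      (s4Kernels.stabilizeIter m 1).map σ.toMonoidHom = s4Kernels.stabilizeIter m j := by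
  have key : ∀ i j : Fin 3, i ≠ j → ∃ π : Equiv.Perm (Fin 3), π 0 = i ∧ π 1 = j := by decide
  obtain ⟨π, h0, h1⟩ := key i j hij
  obtain ⟨σ, hσ⟩ := stabilizeIter_slotSymmetric m π
  exact ⟨σ, by rw [hσ, h0], by rw [hσ, h1]⟩

/-- Slot permutation invariance of the trisection property. [folklore] -/
theorem isGroupTrisection_comp_perm {g k : ℕ} {G : Type*} [Group G] {K : TrisectionKernels g}
    (hK : IsGroupTrisection g k G K) (π : Equiv.Perm (Fin 3)) :
    IsGroupTrisection g k G (fun i => K (π i)) := by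
  refine ⟨fun i => hK.normal (π i), fun i => hK.free_quotient (π i),
    fun i j hij => hK.free_pairQuotient (π i) (π j) (fun h => hij (π.injective h)), ?_⟩
  obtain ⟨e⟩ := hK.triple
  refine ⟨(QuotientGroup.quotientMulEquivOfEq ?_).trans e⟩
  change normalClosure (⋃ i, ((K (π i) : Subgroup (SurfaceGroup g)) : Set (SurfaceGroup g))) =
    normalClosure (⋃ i, ((K i : Subgroup (SurfaceGroup g)) : Set (SurfaceGroup g)))
  rw [π.surjective.iUnion_comp (fun i => ((K i : Subgroup (SurfaceGroup g)) : Set (SurfaceGroup g)))]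


/-- **The crux is its `(0,1)`-slice**: by slot symmetry of `N` and slot-permutation invariance of
the hypothesis, it suffices to standardise the FIRST pair of every trisection of the trivial group.
[folklore] -/
theorem waldhausenPairs_iff_slice :
    WaldhausenPairs ↔ ∀ (m : ℕ) (K : TrisectionKernels (3 + 3 * m)),
      IsGroupTrisection (3 + 3 * m) (m + 1) (PUnit : Type) K →
        ∃ α : SurfaceGroup (3 + 3 * m) ≃* SurfaceGroup (3 + 3 * m),
          (s4Kernels.stabilizeIter m 0).map α.toMonoidHom = K 0 ∧
          (s4Kernels.stabilizeIter m 1).map α.toMonoidHom = K 1 := by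
  constructor
  · exact fun h m K hK => h m K hK 0 1 (by decide)
  · intro h m K hK i j hij
    have key : ∀ i j : Fin 3, i ≠ j → ∃ π : Equiv.Perm (Fin 3), π 0 = i ∧ π 1 = j := by decide
    obtain ⟨π, h0, h1⟩ := key i j hij
    obtain ⟨α, hα0, hα1⟩ := h m (fun l => K (π l)) (isGroupTrisection_comp_perm hK π)
    obtain ⟨σ, hσ⟩ := stabilizeIter_slotSymmetric m π
    have ht : (σ.symm.trans α).toMonoidHom = α.toMonoidHom.comp σ.symm.toMonoidHom :=
      MonoidHom.ext fun _ => rfl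
    have hs : ∀ l, (s4Kernels.stabilizeIter m (π l)).map σ.symm.toMonoidHom =
        s4Kernels.stabilizeIter m l := fun l => by
      rw [← hσ l, Subgroup.map_map]
      have : σ.symm.toMonoidHom.comp σ.toMonoidHom = MonoidHom.id _ :=
        MonoidHom.ext fun x => σ.symm_apply_apply x
      rw [this, Subgroup.map_id]
    refine ⟨σ.symm.trans α, ?_, ?_⟩
    · rw [ht, ← Subgroup.map_map, ← h0, hs 0, hα0, h0]
    · rw [ht, ← Subgroup.map_map, ← h1, hs 1, hα1, h1]

end SlotSymmetry

/-! ## §T Targets — the registered stubs of the three lines (cycle 2, 2026-08-16)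

Skeletons registered for this crux (`Cruxes/WaldhausenPairs/Lines/`): `jaco-splitting-homomorphism`
(stubs S1 `stub_jacoPairRealization`, S2 `stub_vanKampenPairQuotient`, S3 `stub_kernelPairTransport`,
S4 `stub_kneserStallingsPerelman`, S5 `stub_waldhausen`), `agk-realization-device`
(`stub_agkRealization`, `stub_waldhausen`, `stub_freePiOneRecognition`, `stub_gluedOrientable`,
`stub_pairRealization`, `stub_kernelTransport`), `zieschang-orbit-dnb-regluing`
(`stub_handlebodyKernelsOneOrbit`, `stub_markedModelHandlebody`, `stub_dehnNielsenBaer`,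
`stub_regluedDouble`, `stub_kneserStallingsPerelman`, `stub_waldhausen`, `stub_triplesTransport`).
No PICKED.md yet; no stuck stubs handed over.  Cheap attacks run on every stub SIGNATURE (junk
models of the relational vocabulary, degenerate genera, dropped hypotheses); verdicts:

* ALL STUBS SURVIVE — none is false as stated.  Reasons, stub by stub:
  - `BoundaryData` is an embedding onto the WHOLE boundary (`range_incl = I.boundary M`,
    Cobordism.lean), `IsBoundaryGluingWith` makes the two pieces cover the glued manifold and meet
    exactly along the seam (`range_union_range`, `apply_eq_apply_iff`, `injective_right`), and
    Mathlib has `Diffeomorph.image_boundary` — so the transport stubs (S3 / `stub_kernelTransport` /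
    `stub_triplesTransport`) are honest: `ψ₁` restricts to `σ : ∂H₁ ≅ ∂H₁'` with
    `ψ₁ ∘ incl = incl' ∘ σ`, the seam identities give `ψ₂ ∘ incl₂ ∘ f = incl₂' ∘ f' ∘ σ`
    (resp. `φ' ∘ f = f' ∘ φ` for the reglued double), and the rest is the pure algebra
    `kernelPair_transport_core` below (α := μ⁻¹ ∘ (base change) ∘ σ_* ∘ μ); base change needs the
    target seam connected (hypothesis present; connected manifold ⇒ path connected).
  - S2 / the van Kampen half of `stub_regluedDouble`: once `π₁(seam) ↠ π₁Y` with kernel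
    `normalClosure (ker₁ ∪ ker₂)` (tree: `VanKampen.surjective_and_ker_eq_of_closed_cover_collars`
    + surjectivity of `π₁∂H → π₁H` from `IsHandlebody`), the statement is `isFreeOfRank_of_ker_eq`
    below.  LOAD-BEARING hypothesis: `IsHandlebody` (surjectivity); with pieces `Σ_g × [0,1]`
    (two boundary components each, kernels trivial) the conclusion fails (`π₁` of the doubled
    product is `S_g × ℤ`, not a quotient of `S_g`) — not formalised (needs the manifolds).
  - S1 / `stub_pairRealization` / `stub_markedModelHandlebody` / `stub_regluedDouble` are
    ∃-statements over an inhabited vocabulary (`FlowerHandlebody`, `exists_isBoundaryGluing_holds`,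
    `nonempty_boundaryData_holds`); mathematically Hempel L14.5 / GK Def. 1; not refutable by models.
  - `stub_dehnNielsenBaer` (pointed DNB with a base path, ALL `g`): `μ : S_g ≃* π₁(F,x)` pins `F`
    to the closed orientable genus-`g` surface (non-orientable closed surfaces have 2-torsion in
    `H₁`, `S_g^{ab} = ℤ^{2g}` has none; classification), and for `g ≥ 1`
    `Aut π₁(Σ_g, x) = Mod^±(Σ_g, x)` (Farb–Margalit Thm 8.8; `g = 1`: `GL₂(ℤ)` acts linearly on
    `T²` fixing `x`; `g = 0`: `f = id`), smooth = topological for surfaces — true at every `g`,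
    the path `ζ` only adds slack.
  - `stub_gluedOrientable`: both pieces orientable + seam = whole boundary, connected ⇒ glued
    manifold orientable (flip one piece) — true; `stub_handlebodyKernelsOneOrbit` = Zieschang /
    LR02 L2.2 + DNB — true; S4, S5, `stub_agkRealization` = registered named facts, whose ORDERED
    form is consistent with §B'' (`exists_swap_s4Kernels`).
* Consequently the kernel-checked compositions prove `HeegaardPairOrbit g k` for ALL `g ≥ 2`, all
  `k` (jaco line); for `k = 0` this is Jaco's group-theoretic Poincaré conjecture (Hempel Thm 14.6)
  — consistent only because S4 carries Perelman (crux NOTES §1, PC3-hardness); a future line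
  WITHOUT a Perelman-bearing stub that still proves `HeegaardPairOrbit g 0` is refutable on sight.
-/

section targets

variable {S G G' P₁ P₂ P₁' P₂' : Type*} [Group S] [Group G] [Group G'] [Group P₁] [Group P₂]
  [Group P₁'] [Group P₂']

/-- ALGEBRAIC CORE of the transport stubs (S3 `stub_kernelPairTransport`, `stub_kernelTransport`,
`stub_triplesTransport`): if an isomorphism `σ : G ≃* G'` (the homeomorphism of seams composed
with the base change, on `π₁`) pulls the two target kernels back to the two source kernels, then
`α := μ'⁻¹ ∘ σ ∘ μ` carries the marked kernel pair to the marked kernel pair — ONE `α` for both,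
which is where simultaneity lives (`not_pairTransfer`).  Everything else in those stubs is
topological plumbing (boundary invariance, seam identities, naturality of base change). [folklore] -/
theorem kernelPair_transport_core (μ : S ≃* G) (μ' : S ≃* G') (σ : G ≃* G')
    (φ₁ : G →* P₁) (φ₂ : G →* P₂) (φ₁' : G' →* P₁') (φ₂' : G' →* P₂')
    (h₁ : φ₁'.ker.comap σ.toMonoidHom = φ₁.ker) (h₂ : φ₂'.ker.comap σ.toMonoidHom = φ₂.ker) :
    ∃ α : S ≃* S,
      (φ₁.ker.comap μ.toMonoidHom).map α.toMonoidHom = φ₁'.ker.comap μ'.toMonoidHom ∧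
      (φ₂.ker.comap μ.toMonoidHom).map α.toMonoidHom = φ₂'.ker.comap μ'.toMonoidHom := by
  refine ⟨μ.trans (σ.trans μ'.symm), ?_, ?_⟩
  · ext x
    rw [Subgroup.mem_map_equiv, Subgroup.mem_comap, Subgroup.mem_comap, ← h₁, Subgroup.mem_comap]
    simp
  · ext x
    rw [Subgroup.mem_map_equiv, Subgroup.mem_comap, Subgroup.mem_comap, ← h₂, Subgroup.mem_comap]
    simp

/-- ALGEBRAIC CORE of the van Kampen stubs (S2 `stub_vanKampenPairQuotient`, the `π₁` clause of
`stub_regluedDouble`): once `π₁(seam) ↠ π₁(Y)` is onto with kernel the normal closure of the two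
handlebody kernels, rank-`k` freeness of the pair quotient IS rank-`k` freeness of `π₁(Y)`.
[folklore] -/
theorem isFreeOfRank_of_ker_eq {P : Type*} [Group P] (π : G →* P) (hπ : Function.Surjective π)
    (N : Subgroup G) [N.Normal] (hker : π.ker = N) {k : ℕ} (h : IsFreeOfRank (G ⧸ N) k) :
    IsFreeOfRank P k :=
  h.of_mulEquiv ((QuotientGroup.quotientMulEquivOfEq hker.symm).trans
    (QuotientGroup.quotientKerEquivOfSurjective π hπ))

end targets

/-! ## §D Open strengthening (not attackable by finite models) -/

/-- STRENGTHENING `TripleStandard`: one automorphism for all three kernels (`Iso N K`) for every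
balanced group trisection of the trivial group. This is SPC4 at genus `g` AND 4-dimensional
Waldhausen at genus `g` (Meier–Schirmer–Zupan Conj. 3.11, 'likely false'); a counterexample is an
exotic 4-sphere or a non-standard balanced trisection of `S⁴` — no small model exists, nothing
to compute. Recorded, not attacked. [folklore] -/
def TripleStandard : Prop :=
  ∀ (m : ℕ) (K : TrisectionKernels (3 + 3 * m)),
    IsGroupTrisection (3 + 3 * m) (m + 1) (PUnit : Type) K →
    TrisectionKernels.Iso (s4Kernels.stabilizeIter m) K

/-- `TripleStandard` trivially implies the crux (so a refutation of the crux would refute it,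
not conversely). [folklore] -/
theorem waldhausenPairs_of_tripleStandard (h : TripleStandard) : WaldhausenPairs := by
  intro m K hK i j _
  obtain ⟨α, hα⟩ := h m K hK
  exact ⟨α, hα i, hα j⟩

end Summit.SmoothPoincare4.SmoothPoincare4.Cruxes.WaldhausenPairs.Disproof

end
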